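import Mathlib.RepresentationTheory.Homological.GroupHomology.Functoriality
import Mathlib.RepresentationTheory.Homological.GroupCohomology.Functoriality
import Mathlib.LinearAlgebra.PiTensorProduct.Basic
import Mathlib.Algebra.Module.LocalizedModule.Basic
import Mathlib.Algebra.Algebra.Subalgebra.Lattice
import Mathlib.Data.ENat.Lattice
import Literature.NumberTheory.Automorphic.CompletedCohomologyHeckeAlgebraGLnHolds
import Literature.Computability.AlgebraicComplexity.LinSubst
import HarnessLib

/-!
# Integral weight-`λ` (co)homology of congruence subgroups of `GL₂` over a number field as a
Hecke module ("coefficients at `p`")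

Topic `NumberTheory/Automorphic` (definition request `defn-IntegralWeightHeckeModuleGL2`, route
`Langlands/RuelleTorsionArtinWeight`, layer-2 items `ArtinTorsionExcess`,
`WeightPointFromTorsionGrowth`).  Namespace `Literature.NumberTheory.Automorphic`; grouping
sub-namespaces `LevelAction` (the generic construction: a level acting on the coefficients) and
`IntegralWeightGL2` (the case `GL₂ / K`); headline object
`Literature.NumberTheory.Automorphic.IntegralWeightHeckeModuleGL2 λ U i = H_i(U, V_λ(𝒪))`.

## What is constructed (no axioms, no `sorry`, no named facts)

**(A) Hecke operators of a monoid on level-invariants (`LevelAction`, abstract).**  For a group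
`𝒢`, a submonoid `Δ ≤ 𝒢` acting `R`-linearly on a module `M` (`θ : Δ →* End_R M`) and a level
`U ≤ 𝒢` (with `U ⊆ Δ`): the invariants `M^U` (`invariants`) and the double-coset operators
`[UαU] = ∑_{d ∈ UαU/U} act(d̃)` (`heckeOp`; `act` = `θ` extended by zero, `doubleCosetQuot` of
`ArithmeticQuotientCohomology`), i.e. `[UαU]·m = ∑ᵢ αᵢ·m` for `UαU = ⊔ αᵢU` — the action of the
Hecke algebra `ℋ(Δ, U)` on the `U`-invariants of a `Δ`-module
[cite: NewtonThorne2016, §2.2.1 Lemma 2.3] [cite: AllenCalegariCaraianiGeeEtAl2023, §2.1.3].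
PROVED: independence of the representatives on `M^U` (`heckeOp_apply_eq_sum_of_rep`),
`[UαU] M^U ⊆ M^U` (`heckeOp_apply_mem`), the commutation of every `[UαU]` with `[UzU]` for `z`
central (`heckeOp_comm_apply_of_central`), and — reusing `ArithmeticQuotient.IsUnramifiedLevel`
and its local–global coset correspondence `bijOn_localCoset` — the local description at an
unramified place (`heckeOp_apply_eq_sum_local`) and the commutation of operators at two different
unramified places (`heckeOp_comm_apply_of_orthogonal`) [cite: KhareThorne2017, §6.2].

**(B) The function model (`LevelAction`, for `ι : Γ →* 𝒢` and `τ : Δ →* End_R V`).**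
* `fnAction`: `Δ` acting on `Fun(𝒢, V)` by `(δ·f)(g) = τ(δ) f(gδ)`; its `U`-invariants
  `sections Δ τ U = M(U, τ) = {f | τ(u) f(gu) = f(g)}` (i.e. `f(gu) = u⁻¹ f(g)`) are the global
  sections over `X × 𝒢/U` of the local system `(X × 𝒢 × V)/U`, `(x, g, v)u = (x, gu, u⁻¹v)`, on
  which `Γ = G(F)` acts by LEFT TRANSLATION ONLY (`leftTranslation`, `rep`): the integral
  "coefficients at `p`" model of Hida [cite: Hida1994AIF, §1] and of
  [cite: AllenCalegariCaraianiGeeEtAl2023, §2.1.2] (an `R[G(F) × K_S]`-module with `G(F)` acting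
  trivially on `V`), versus the "coefficients at `∞`" model `TwistedQuotient.coeffRepresentation`
  of `CuspidalCohomologyGL` (`Γ` acting on `V`, the level not);
* `compactSections` (`M_c`: sections supported on finitely many cosets `gU`) — the compactly
  INDUCED module `⊕_x ind V` as opposed to the coinduced `∏_x Ind V` [cite: NewtonThorne2016, §2.1];
* `cohomology ι Δ τ U i = H^i(Γ, M(U,τ))` (Mathlib `groupCohomology`; Shapiro:
  `∏_{x ∈ Γ\𝒢/U} H^i(Γ_x, V)`, `Γ_x = Γ ∩ xUx⁻¹` acting through `τ`) and
  `homology ι Δ τ U i = H_i(Γ, M_c(U,τ))` (Mathlib `groupHomology`; Shapiro: `⊕_x H_i(Γ_x, V)` —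
  homology needs the induced, not the coinduced, module), the (co)homology of the arithmetic
  quotient `Γ\(X × 𝒢/U)` (as a stack, `X` contractible; conventions of
  `ArithmeticQuotientCohomology`) with coefficients in the local system of `τ`;
* the Hecke operators on both (`heckeRepHom`, `heckeRepHomC`, `heckeCohomology`, `heckeHomology`:
  functoriality of group (co)homology; on `M_c` for a Hecke pair `[IsHeckeTriple ⊤ U U]`, using
  `supportMod_heckeOp_subset`), and the descent of commutation relations
  (`heckeCohomology_comm`, `heckeHomology_comm`);
* the COMPARISON with coefficients at `∞`: when `τ = σ|_Δ` for an action `σ` of all of `𝒢` on `V`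
  (e.g. `V = V_λ(K_p)`), `sectionsEquivLevelFunctions : M(U, τ) ≃ₗ Fun(𝒢 ⧸ U, V)`,
  `f ↦ (gU ↦ σ(g) f(g))`, intertwining left translation with the twisted action
  `(γF)(c) = σ(ιγ) F(ι(γ)⁻¹c)` (`toLevelFunctions_leftTranslation`) — Hida's identification
  `(t g_∞, P) ↦ (…, t_p⁻¹ P)` [cite: Hida1994AIF, §1]; so after `⊗ ℚ_p` ON THE COEFFICIENTS the two
  models have isomorphic (co)homology by functoriality (the packaged isomorphism with
  `TwistedQuotient.cohomology` is left to a file importing `CuspidalCohomologyGL`; the integral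
  statement `H(U, V_λ(𝒪)) ⊗ ℚ_p ≅ H(U, V_λ(K_p))` also needs flat base change, not formalised).

**(C) `GL₂` over a number field `K` (`IntegralWeightGL2`).**
* `integralAt K n v = M_n(𝒪_v) ∩ GL_n(K_v)` (a submonoid ⊇ `GL_n(𝒪_v)`, `toIntMatrix`), Hida's
  semigroup at `p` without the ordinarity condition [cite: Hida1994AIF, §1 (1.7)];
* `SymPow 𝒪 m = Sym^m(𝒪²)` = homogeneous forms of degree `m` in `X₀, X₁`
  (`MvPolynomial.homogeneousSubmodule`) with the INTEGRAL action `symPowAction` of all of `M₂(𝒪)`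
  by linear substitution (the tree's `linSubstMonoidHom`; degree `1` is the standard
  representation, so degree `m` is `Sym^m`, highest weight `(m, 0)`); `linSubst_diagonal_monomial`:
  `diag(d₀,d₁) X₀^aX₁^b = d₀^a d₁^b X₀^aX₁^b`, so `diag(ϖ,1)` acts `p`-integrally with eigenvalue
  `1` on `X₁^m` — for `λ_v = (k_v, 0)` this is the renormalised action `g ·_p x = α_λ(g)⁻¹ g·x` of
  [cite: AllenCalegariCaraianiGeeEtAl2023, §2.2.2] at `diag(ϖ_v, 1)` (in general the two differ on
  `Iw diag(ϖ^a,ϖ^b) Iw`, `a ≥ b`, by the scalar `τ(ϖ)^{b k}`);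
* `IntegralWeight K 𝒪 J`: a weight datum `λ = (place j, emb j : 𝒪_{place j} →+* 𝒪, deg j = k_j)_j`
  (intended: `J` = embeddings `K ↪ E ⊇ K_v`, `v ∣ p`, `𝒪 = 𝒪_E`; for `K` imaginary quadratic and
  `p = v v̄` split, `J = {v, v̄}`, `𝒪 = ℤ_p`, `λ = (k, k')`), with `IntegralWeight.single v k`
  (`Sym^k` at one place, `𝒪 = 𝒪_v`); `CoeffModule λ = V_λ(𝒪) = ⊗_j Sym^{k_j}(𝒪²)`
  (`PiTensorProduct`) [cite: AllenCalegariCaraianiGeeEtAl2023, §2.2.1];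
  `heckeMonoid λ = Δ_λ` (finite-adelic matrices integral at the places of `λ`) acting by
  `coeffAction λ = τ_λ` (factor `j` through `emb j (g_{place j})`, `coeffAction_apply_tprod`);
  levels `U ≤ GL₂(𝒪̂_K)` lie in `Δ_λ` (`le_heckeMonoid`), as do all Hecke elements `t_{w,i}`
  (`heckeElement_mem_heckeMonoid`) and `GL₂(K_w)` for `w` not a place of `λ`;
* **`IntegralWeightHeckeModuleGL2 λ U i = H_i(U, V_λ(𝒪))`** and `IntegralWeight.cohomology λ U i =
  H^i(U, V_λ(𝒪))` for `Γ = GL₂(K) → 𝒢 = GL₂(𝔸_K^∞)` (`BigHeckeGLn.globalEmbedding`); the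
  operators `hecke`/`heckeCoh` of `g ∈ Δ_λ`, **`heckeT w = T_w = [U diag(ϖ_w,1) U]`**,
  **`heckeS w = S_w = [U diag(ϖ_w,ϖ_w) U]`** (`BigHeckeGLn.heckeElement`), and **`heckeU v = U_v`**
  (the same double coset at a place of `λ`, with the integral `Sym` action: the `p`-integral `U_v`);
* **`anemicHeckeAlgebra λ hU S i = 𝒪[T_w, S_w : w ∉ S] ⊆ End_𝒪 H_i(U, V_λ(𝒪))`**
  (`Algebra.adjoin`), PROVED commutative (`anemicGenerators_comm`, `commRing`) when `S` contains
  the places of `λ` and `U = Uʷ × GL₂(𝒪_w)` (`IsUnramifiedLevel`) at every `w ∉ S` — for the levels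
  `𝒰.tower r` of a `TameLevel` this is `TameLevel.isUnramifiedLevel_tower`;
* **`localizedHomology … 𝔪 = H_i(U, V_λ(𝒪))_𝔪`** (Mathlib `LocalizedModule` at `𝕋 ∖ 𝔪`, `𝔪` a
  maximal ideal of the anemic algebra; `localizedHomology.of` the localisation map)
  and **`heckeTorsionExponent p … 𝔪 = inf {t | p^t H_i(U, V_λ(𝒪))_𝔪 = 0} ∈ ℕ∞`**
  (`torsionExponent`; `⊤` when no power of `p` kills the `𝔪`-part).

## Conventions and design notes

* Everything integral is over an arbitrary commutative ring `𝒪` of coefficients (`ℤ_p`, `𝒪_E`,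
  `𝒪_E/ϖ^t`, `𝒪_v`); Mathlib's group (co)homology forces `𝒪`, `GL₂(K)`, `GL₂(𝔸_K^∞)`, `V_λ` into
  one universe (`Type`).  `CoeffModule` is a `def` with its own instances (one instance path).
* `T_w`, `S_w`, `U_v` use the fixed uniformiser `BigHeckeGLn.uniformizerAt`; for `w` hyperspecial
  the double cosets do not depend on it, `U_v` does
  [cite: AllenCalegariCaraianiGeeEtAl2023, §2.2.2].  Frobenius/normalisation dictionaries are those
  of `CompletedCohomologyHeckeAlgebraGLn`.
* Junk values (documented on the declarations): `act = 0` off `Δ`; `heckeOp = 0` when `UαU/U` is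
  infinite (never for a Hecke pair); `invariants = 0` if `U ⊄ Δ`; `torsionExponent` for `p ≤ 1`.
* Determinant twists are NOT included (`V_λ(𝒪) = ⊗ Sym^{k_j}`, `λ_j = (k_j, 0)`): `det^{w}` is a
  finite-order character on the arithmetic groups for `K` imaginary quadratic and changes `T_w` by a
  scalar; `-- TODO(general form): λ_j = (k_j + w_j, w_j)` with the unit-part normalisation at `p`,
  and `GL_n` with integral Weyl modules.
* NOT here: Hida's control theorem and the `Λ`-torsion of the nearly ordinary Hecke algebra over
  fields with a complex place [cite: Hida1994AIF, Thm. 3.2 and §4] [cite: Hida1993Duke] (to be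
  vendored as cite-facts on request), the ordinary idempotent `e = lim U_p^{n!}`, the comparison
  with singular homology of Bianchi manifolds for neat levels, the torsion Jacquet–Langlands
  numerology of [cite: CalegariVenkatesh2019], Galois representations
  (`Scholze2015_galoisRep_of_modPEigensystem`, `TorsionHeckeEigensystem`), and the link with the
  completed (co)homology `TameLevel.completedCohomology` (trivial coefficients along the `p`-tower).

## References

* H. Hida, *p-adic ordinary Hecke algebras for GL(2)*, Ann. Inst. Fourier 44 (1994), §1
  (pp. 1291–1295: `L(n,v;A)`, the covering `G(ℚ)\G(𝔸) × M / U F_∞C_∞₊`, the semigroup `D`, `[δ]`,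
  `(UδU)`), Thm. 3.2 [Hida1994AIF]; H. Hida, Duke Math. J. 69 (1993) [Hida1993Duke].
* P. Allen, F. Calegari, A. Caraiani, T. Gee, D. Helm, B. Le Hung, J. Newton, P. Scholze,
  R. Taylor, J. Thorne, *Potential automorphy over CM fields*, Ann. of Math. 197 (2023), §2.1.2
  (coefficient systems), §2.1.3 (Hecke algebra of a monoid), §2.2.1 (`𝒱_λ`, `𝕋^S(K,λ)`), §2.2.2
  (`T_{v,i}`, `U_{v,i}`, `Δ_v`, `·_p`) [AllenCalegariCaraianiGeeEtAl2023].
* J. Newton, J. Thorne, *Torsion Galois representations over CM fields and Hecke algebras in the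
  derived category*, Forum Math. Sigma 4 (2016), §2.1 (`Ind`, `ind`), §2.2.1 Lemma 2.3
  [NewtonThorne2016].
* C. Khare, J. Thorne, Amer. J. Math. 139 (2017), §6.2 [KhareThorne2017].
* F. Calegari, A. Venkatesh, *A torsion Jacquet–Langlands correspondence*, Astérisque 409 (2019),
  Ch. 2–3 [CalegariVenkatesh2019]; F. Calegari, M. Emerton, *Completed cohomology — a survey*
  (2011), §2 [CalegariEmerton2011]; T. Gee, J. Newton, JIMJ 21 (2020), §2.1 [GeeNewton2020].
-/

noncomputable section

open CategoryTheory MulAction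

universe u

namespace Literature.NumberTheory.Automorphic

namespace LevelAction

/-! ### (A) The Hecke action of a submonoid on the level-invariants of a module -/

section Abstract

variable {R : Type u} [CommRing R] {𝒢 : Type u} [Group 𝒢] {M : Type u} [AddCommGroup M]
  [Module R M] (Δ : Submonoid 𝒢) (θ : Δ →* Module.End R M)

open scoped Classical in
/-- The action `θ` of the submonoid `Δ ≤ 𝒢` on `M`, extended BY ZERO to a function on all of `𝒢`
(junk value `0` off `Δ`; every use below is at elements of `Δ`).  This device lets double-coset
sums be written over arbitrary coset representatives. [folklore] -/
def act (g : 𝒢) : Module.End R M :=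
  if h : g ∈ Δ then θ ⟨g, h⟩ else 0

variable {Δ θ}

/-- On `Δ`, `act` is `θ`. [folklore] -/
theorem act_of_mem {g : 𝒢} (h : g ∈ Δ) : act Δ θ g = θ ⟨g, h⟩ := by
  rw [act, dif_pos h]

/-- Off `Δ`, `act` is the documented junk value `0`. [folklore] -/
theorem act_of_not_mem {g : 𝒢} (h : g ∉ Δ) : act Δ θ g = 0 := by
  rw [act, dif_neg h]

variable (Δ θ) in
/-- `act 1 = 1`. [folklore] -/
@[simp]
theorem act_one : act Δ θ 1 = 1 := by
  rw [act_of_mem Δ.one_mem]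
  exact map_one θ

/-- `act` is multiplicative on `Δ`. [folklore] -/
theorem act_mul {g h : 𝒢} (hg : g ∈ Δ) (hh : h ∈ Δ) :
    act Δ θ (g * h) = act Δ θ g * act Δ θ h := by
  rw [act_of_mem (Δ.mul_mem hg hh), act_of_mem hg, act_of_mem hh, ← map_mul]
  rfl

variable (Δ θ) (U : Subgroup 𝒢)

/-- **The `U`-invariants `M^U`** of the `Δ`-module `M` for a level `U` (intended: `U ⊆ Δ`; an
element of `U` outside `Δ` acts by the junk value `0` and then forces `M^U = 0`).
[cite: NewtonThorne2016, §2.2.1 Lemma 2.3] -/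
def invariants : Submodule R M where
  carrier := {m | ∀ u ∈ U, act Δ θ u m = m}
  zero_mem' u _ := map_zero _
  add_mem' {a b} ha hb u hu := by rw [map_add, ha u hu, hb u hu]
  smul_mem' c m hm u hu := by rw [map_smul, hm u hu]

variable {Δ θ U} in
/-- Membership in `M^U` (definitional). [folklore] -/
theorem mem_invariants_iff {m : M} : m ∈ invariants Δ θ U ↔ ∀ u ∈ U, act Δ θ u m = m :=
  Iff.rfl

open scoped Classical in
/-- **The double-coset (Hecke) operator `[U α U] = ∑_{d ∈ UαU/U} act(d̃)`** on `M`, the sum over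
the left cosets `d ⊆ U α U` of `act` of the representative `d̃ = d.out`
(`ArithmeticQuotient.doubleCosetQuot U α = UαU/U ⊆ 𝒢 ⧸ U`): on `M^U`, for `α ∈ Δ ⊇ U`, this is
`[UαU] · m = ∑ᵢ αᵢ · m` for ANY decomposition `UαU = ⊔ᵢ αᵢ U` (`heckeOp_apply_eq_sum_of_rep`), the
action of the Hecke algebra `ℋ(Δ, U)` on `U`-invariants of a `Δ`-module
[cite: NewtonThorne2016, §2.2.1 Lemma 2.3] [cite: AllenCalegariCaraianiGeeEtAl2023, §2.1.3].
Junk value `0` when `UαU/U` is infinite (never, for a Hecke pair `[IsHeckeTriple ⊤ U U]`). -/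
def heckeOp (α : 𝒢) : Module.End R M :=
  if h : (ArithmeticQuotient.doubleCosetQuot U α).Finite then ∑ d ∈ h.toFinset, act Δ θ d.out
  else 0

variable {Δ θ U}

open scoped Classical in
/-- Unfolding lemma for `heckeOp` in the finite case. [folklore] -/
theorem heckeOp_eq_sum {α : 𝒢} (h : (ArithmeticQuotient.doubleCosetQuot U α).Finite) :
    heckeOp Δ θ U α = ∑ d ∈ h.toFinset, act Δ θ d.out := by
  rw [heckeOp, dif_pos h]

/-- The documented junk value: `heckeOp = 0` when `UαU/U` is infinite. [folklore] -/
theorem heckeOp_eq_zero_of_infinite {α : 𝒢}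
    (h : ¬ (ArithmeticQuotient.doubleCosetQuot U α).Finite) : heckeOp Δ θ U α = 0 := by
  rw [heckeOp, dif_neg h]

/-- Every left coset in `UαU/U` is `(u α) U` for some `u ∈ U`. [folklore] -/
theorem exists_mk_eq_of_mem_doubleCosetQuot {α : 𝒢} {d : 𝒢 ⧸ U}
    (hd : d ∈ ArithmeticQuotient.doubleCosetQuot U α) :
    ∃ u ∈ U, ((u * α : 𝒢) : 𝒢 ⧸ U) = d := by
  obtain ⟨l, rfl⟩ := hd
  exact ⟨l, l.2, rfl⟩

/-- Representatives of cosets in `UαU/U` lie in `Δ` when `α ∈ Δ ⊇ U`. [folklore] -/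
theorem out_mem_of_mem_doubleCosetQuot (hU : U.toSubmonoid ≤ Δ) {α : 𝒢} (hα : α ∈ Δ)
    {d : 𝒢 ⧸ U} (hd : d ∈ ArithmeticQuotient.doubleCosetQuot U α) : d.out ∈ Δ := by
  obtain ⟨u, hu, rfl⟩ := exists_mk_eq_of_mem_doubleCosetQuot hd
  obtain ⟨u', hu'⟩ := QuotientGroup.mk_out_eq_mul U (u * α)
  rw [hu']
  exact Δ.mul_mem (Δ.mul_mem (hU hu) hα) (hU u'.2)

/-- **Independence of the representative**: on `m ∈ M^U`, `act (y u) m = act y m` for `y ∈ Δ`,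
`u ∈ U ⊆ Δ`. [folklore] -/
theorem act_mul_apply_of_mem_invariants (hU : U.toSubmonoid ≤ Δ) {m : M}
    (hm : m ∈ invariants Δ θ U) {y u : 𝒢} (hy : y ∈ Δ) (hu : u ∈ U) :
    act Δ θ (y * u) m = act Δ θ y m := by
  rw [act_mul hy (hU hu), Module.End.mul_apply, hm u hu]

/-- On `m ∈ M^U`, `act d̃ m = act y m` for any representative `y ∈ Δ` of the coset `d = yU`.
[folklore] -/
theorem act_out_apply_eq (hU : U.toSubmonoid ≤ Δ) {m : M} (hm : m ∈ invariants Δ θ U)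
    {y : 𝒢} (hy : y ∈ Δ) (d : 𝒢 ⧸ U) (hyd : (y : 𝒢 ⧸ U) = d) :
    act Δ θ d.out m = act Δ θ y m := by
  obtain ⟨u, hu⟩ : ∃ u : U, d.out = y * u := by
    refine ⟨⟨y⁻¹ * d.out, ?_⟩, by simp⟩
    rw [← QuotientGroup.eq, hyd, QuotientGroup.out_eq']
  rw [hu, act_mul_apply_of_mem_invariants hU hm hy u.2]

open scoped Classical in
/-- **`[UαU] · m = ∑ᵢ act(αᵢ) m` for any system of representatives**: if `y : UαU/U → 𝒢` picks a
representative `y d ∈ Δ` of each coset `d`, then on `m ∈ M^U` the Hecke operator is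
`∑_d act (y d) m`. [cite: NewtonThorne2016, §2.2.1 Lemma 2.3] -/
theorem heckeOp_apply_eq_sum_of_rep (hU : U.toSubmonoid ≤ Δ) {α : 𝒢}
    (h : (ArithmeticQuotient.doubleCosetQuot U α).Finite) {m : M} (hm : m ∈ invariants Δ θ U)
    (y : 𝒢 ⧸ U → 𝒢) (hy : ∀ d ∈ ArithmeticQuotient.doubleCosetQuot U α, y d ∈ Δ)
    (hyd : ∀ d ∈ ArithmeticQuotient.doubleCosetQuot U α, ((y d : 𝒢) : 𝒢 ⧸ U) = d) :
    heckeOp Δ θ U α m = ∑ d ∈ h.toFinset, act Δ θ (y d) m := by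
  rw [heckeOp_eq_sum h, LinearMap.sum_apply]
  refine Finset.sum_congr rfl fun d hd => ?_
  rw [Set.Finite.mem_toFinset] at hd
  exact act_out_apply_eq hU hm (hy d hd) d (hyd d hd)

open scoped Classical in
/-- **`[UαU]` preserves `M^U`** (`α ∈ Δ ⊇ U`): `act v ∘ ∑_d act d̃ = ∑_d act (v d̃)` and `v d̃`
represents `v • d`, a permutation of `UαU/U`. [cite: NewtonThorne2016, §2.2.1 Lemma 2.3] -/
theorem heckeOp_apply_mem (hU : U.toSubmonoid ≤ Δ) {α : 𝒢} (hα : α ∈ Δ) {m : M}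
    (hm : m ∈ invariants Δ θ U) : heckeOp Δ θ U α m ∈ invariants Δ θ U := by
  by_cases h : (ArithmeticQuotient.doubleCosetQuot U α).Finite
  swap
  · rw [heckeOp_eq_zero_of_infinite h, LinearMap.zero_apply]
    exact Submodule.zero_mem _
  intro v hv
  rw [heckeOp_eq_sum h, LinearMap.sum_apply, map_sum]
  have hterm : ∀ d ∈ h.toFinset,
      act Δ θ v (act Δ θ d.out m) = act Δ θ ((v : 𝒢) • d).out m := by
    intro d hd
    rw [Set.Finite.mem_toFinset] at hd
    have hdΔ : d.out ∈ Δ := out_mem_of_mem_doubleCosetQuot hU hα hd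
    rw [← Module.End.mul_apply, ← act_mul (hU hv) hdΔ]
    refine (act_out_apply_eq hU hm (Δ.mul_mem (hU hv) hdΔ) _ ?_).symm
    conv_rhs => rw [← QuotientGroup.out_eq' d]
    rfl
  rw [Finset.sum_congr rfl hterm]
  exact ArithmeticQuotient.sum_doubleCosetQuot_coe_smul h ⟨v, hv⟩ fun d => act Δ θ d.out m

/-- `[UαU]` restricted to `M^U` (`α ∈ Δ ⊇ U`). [cite: NewtonThorne2016, §2.2.1 Lemma 2.3] -/
def heckeOpInv (hU : U.toSubmonoid ≤ Δ) {α : 𝒢} (hα : α ∈ Δ) :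
    Module.End R (invariants Δ θ U) :=
  (heckeOp Δ θ U α).restrict fun _ hm => heckeOp_apply_mem hU hα hm

/-- Unfolding lemma for `heckeOpInv`. [folklore] -/
@[simp]
theorem coe_heckeOpInv_apply (hU : U.toSubmonoid ≤ Δ) {α : 𝒢} (hα : α ∈ Δ)
    (m : invariants Δ θ U) : (heckeOpInv hU hα m : M) = heckeOp Δ θ U α m :=
  rfl

/-! #### Commutation: central elements, and distinct unramified places -/

open scoped Classical in
/-- For `z ∈ Δ` CENTRAL in `𝒢`, `UzU = zU` and `[UzU] · m = act z m` on `M^U`. [folklore] -/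
theorem heckeOp_apply_of_central (hU : U.toSubmonoid ≤ Δ) {z : 𝒢} (hz : z ∈ Δ)
    (hzc : ∀ g : 𝒢, g * z = z * g) {m : M} (hm : m ∈ invariants Δ θ U) :
    heckeOp Δ θ U z m = act Δ θ z m := by
  have hset : ArithmeticQuotient.doubleCosetQuot U z = {((z : 𝒢) : 𝒢 ⧸ U)} := by
    ext d
    simp only [Set.mem_singleton_iff]
    constructor
    · intro hd
      obtain ⟨u, hu, rfl⟩ := exists_mk_eq_of_mem_doubleCosetQuot hd
      rw [hzc u, QuotientGroup.eq]
      simpa using U.inv_mem hu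
    · rintro rfl
      exact MulAction.mem_orbit_self _
  have hfin : (ArithmeticQuotient.doubleCosetQuot U z).Finite := by
    rw [hset]
    exact Set.finite_singleton _
  rw [heckeOp_apply_eq_sum_of_rep hU hfin hm (fun _ => z) (fun _ _ => hz)
    (fun d hd => by rw [hset] at hd; exact hd.symm)]
  have : hfin.toFinset = {((z : 𝒢) : 𝒢 ⧸ U)} :=
    Finset.ext fun d => by rw [Set.Finite.mem_toFinset, hset]; simp
  rw [this, Finset.sum_singleton]

open scoped Classical in
/-- **A central element of `Δ` gives a Hecke operator commuting with every `[UαU]` on `M^U`.**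
(For `GL₂`: `S_w = [U diag(ϖ_w,ϖ_w) U]` commutes with everything.) [folklore] -/
theorem heckeOp_comm_apply_of_central (hU : U.toSubmonoid ≤ Δ) {z : 𝒢} (hz : z ∈ Δ)
    (hzc : ∀ g : 𝒢, g * z = z * g) {α : 𝒢} (hα : α ∈ Δ) {m : M} (hm : m ∈ invariants Δ θ U) :
    heckeOp Δ θ U α (heckeOp Δ θ U z m) = heckeOp Δ θ U z (heckeOp Δ θ U α m) := by
  rw [heckeOp_apply_of_central hU hz hzc hm,
    heckeOp_apply_of_central hU hz hzc (heckeOp_apply_mem hU hα hm)]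
  by_cases h : (ArithmeticQuotient.doubleCosetQuot U α).Finite
  swap
  · simp [heckeOp_eq_zero_of_infinite h]
  rw [heckeOp_eq_sum h, LinearMap.sum_apply, LinearMap.sum_apply, map_sum]
  refine Finset.sum_congr rfl fun d hd => ?_
  rw [Set.Finite.mem_toFinset] at hd
  have hdΔ : d.out ∈ Δ := out_mem_of_mem_doubleCosetQuot hU hα hd
  rw [← Module.End.mul_apply, ← Module.End.mul_apply, ← act_mul hdΔ hz, ← act_mul hz hdΔ, hzc]

section Place

variable {Gᵥ : Type*} [Group Gᵥ] {Kᵥ : Subgroup Gᵥ} {ιᵥ : Gᵥ →* 𝒢} {πᵥ : 𝒢 →* Gᵥ}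

open scoped Classical in
/-- **At an unramified place the Hecke operator is the local double-coset sum**: if `U` is
unramified at `(Gᵥ, Kᵥ, ιᵥ, πᵥ)` (`ArithmeticQuotient.IsUnramifiedLevel`, i.e. `U = Uᵛ × Kᵥ`) and
`ιᵥ(Gᵥ) ⊆ Δ`, then for `m ∈ M^U`, `[U ιᵥ(a) U] · m = ∑_{yKᵥ ⊆ KᵥaKᵥ} act(ιᵥ ỹ) m` (the local
cosets `yKᵥ ↦ ιᵥ(y)U` biject onto `U ιᵥ(a) U / U`, `IsUnramifiedLevel.bijOn_localCoset`).
[cite: KhareThorne2017, §6.2] -/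
theorem heckeOp_apply_eq_sum_local (h : ArithmeticQuotient.IsUnramifiedLevel Kᵥ ιᵥ πᵥ U)
    (hU : U.toSubmonoid ≤ Δ) (hΔ : ∀ y : Gᵥ, ιᵥ y ∈ Δ) {a : Gᵥ}
    (ha : (orbit Kᵥ (a : Gᵥ ⧸ Kᵥ)).Finite) {m : M} (hm : m ∈ invariants Δ θ U) :
    heckeOp Δ θ U (ιᵥ a) m = ∑ y ∈ ha.toFinset, act Δ θ (ιᵥ y.out) m := by
  have hfin : (ArithmeticQuotient.doubleCosetQuot U (ιᵥ a)).Finite :=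
    (h.finite_doubleCosetQuot_iff a).2 ha
  rw [heckeOp_eq_sum hfin, LinearMap.sum_apply]
  symm
  refine Finset.sum_nbij h.localCoset (fun y hy => ?_)
    (fun y _ z _ hyz => h.localCoset_injective hyz) (fun d hd => ?_) (fun y hy => ?_)
  · rw [Set.Finite.mem_toFinset] at hy ⊢
    exact (h.bijOn_localCoset a).mapsTo hy
  · rw [Finset.mem_coe, Set.Finite.mem_toFinset] at hd
    obtain ⟨y, hy, rfl⟩ := (h.bijOn_localCoset a).surjOn hd
    exact ⟨y, by rwa [Finset.mem_coe, Set.Finite.mem_toFinset], rfl⟩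
  · refine (act_out_apply_eq hU hm (hΔ y.out) _ ?_).symm
    conv_rhs => rw [← QuotientGroup.out_eq' y]
    rw [h.localCoset_mk]

variable {G₁ G₂ : Type*} [Group G₁] [Group G₂] {K₁ : Subgroup G₁} {K₂ : Subgroup G₂}
  {ι₁ : G₁ →* 𝒢} {π₁ : 𝒢 →* G₁} {ι₂ : G₂ →* 𝒢} {π₂ : 𝒢 →* G₂}

open scoped Classical in
/-- **Hecke operators at two different unramified places commute on `M^U`**: with `U`
unramified at both places, `ι₁(G₁), ι₂(G₂) ⊆ Δ`, and the places orthogonal (`π₂ ∘ ι₁ = 1`, so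
`ι₁(y)` and `ι₂(z)` commute), `[U ι₁(a) U] [U ι₂(b) U] = [U ι₂(b) U] [U ι₁(a) U]` on `M^U` — both
are `∑_y ∑_z act(ι₁ỹ ι₂z̃) m`. [cite: KhareThorne2017, §6.2] -/
theorem heckeOp_comm_apply_of_orthogonal (h₁ : ArithmeticQuotient.IsUnramifiedLevel K₁ ι₁ π₁ U)
    (h₂ : ArithmeticQuotient.IsUnramifiedLevel K₂ ι₂ π₂ U) (hU : U.toSubmonoid ≤ Δ)
    (hΔ₁ : ∀ y : G₁, ι₁ y ∈ Δ) (hΔ₂ : ∀ z : G₂, ι₂ z ∈ Δ) (horth : ∀ y : G₁, π₂ (ι₁ y) = 1)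
    (a : G₁) (b : G₂) {m : M} (hm : m ∈ invariants Δ θ U) :
    heckeOp Δ θ U (ι₁ a) (heckeOp Δ θ U (ι₂ b) m) =
      heckeOp Δ θ U (ι₂ b) (heckeOp Δ θ U (ι₁ a) m) := by
  by_cases ha : (orbit K₁ (a : G₁ ⧸ K₁)).Finite
  swap
  · rw [heckeOp_eq_zero_of_infinite (mt (h₁.finite_doubleCosetQuot_iff a).1 ha)]
    simp
  by_cases hb : (orbit K₂ (b : G₂ ⧸ K₂)).Finite
  swap
  · rw [heckeOp_eq_zero_of_infinite (mt (h₂.finite_doubleCosetQuot_iff b).1 hb)]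
    simp
  rw [heckeOp_apply_eq_sum_local h₁ hU hΔ₁ ha (heckeOp_apply_mem hU (hΔ₂ b) hm),
    heckeOp_apply_eq_sum_local h₂ hU hΔ₂ hb (heckeOp_apply_mem hU (hΔ₁ a) hm),
    heckeOp_apply_eq_sum_local h₂ hU hΔ₂ hb hm, heckeOp_apply_eq_sum_local h₁ hU hΔ₁ ha hm]
  simp only [map_sum]
  rw [Finset.sum_comm]
  refine Finset.sum_congr rfl fun z _ => Finset.sum_congr rfl fun y _ => ?_
  rw [← Module.End.mul_apply, ← Module.End.mul_apply, ← act_mul (hΔ₁ _) (hΔ₂ _),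
    ← act_mul (hΔ₂ _) (hΔ₁ _), h₂.comm_of_apply_eq_one _ (horth y.out) z.out]

end Place

end Abstract

/-! ### (B) The function model: `U`-equivariant `V`-valued functions on `𝒢` -/

section Functions

variable {R : Type u} [CommRing R] {Γ 𝒢 : Type u} [Group Γ] [Group 𝒢] (ι : Γ →* 𝒢)
  (Δ : Submonoid 𝒢) {V : Type u} [AddCommGroup V] [Module R V] (τ : Δ →* Module.End R V)
  (U : Subgroup 𝒢)

/-- The action of the monoid `Δ` on functions `𝒢 → V`: `(δ · f)(g) = τ(δ) (f (g δ))` (right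
translation twisted by the action `τ` of `Δ` on the coefficients `V`; Hida's map
`(g, P) ↦ (gδ, δ_p P)`). [cite: Hida1994AIF, §1] -/
def fnAction : Δ →* Module.End R (𝒢 → V) where
  toFun δ := (τ δ).compLeft 𝒢 ∘ₗ LinearMap.funLeft R V fun g : 𝒢 => g * (δ : 𝒢)
  map_one' := by
    refine LinearMap.ext fun f => funext fun g => ?_
    simp
  map_mul' δ₁ δ₂ := by
    refine LinearMap.ext fun f => funext fun g => ?_
    simp [mul_assoc]

/-- Unfolding lemma: `(δ · f)(g) = τ(δ) (f (g δ))`. [folklore] -/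
@[simp]
theorem fnAction_apply (δ : Δ) (f : 𝒢 → V) (g : 𝒢) :
    fnAction Δ τ δ f g = τ δ (f (g * δ)) :=
  rfl

/-- **The sections `M(U, τ) = {f : 𝒢 → V | τ(u) f(g u) = f(g), u ∈ U}`** (i.e. `f(gu) = u⁻¹ f(g)`:
the global sections, over `X × 𝒢/U`, of the local system
`Γ\((X × 𝒢 × V)/U)`, `(x, g, v) u = (x, g u, u⁻¹ v)` — COEFFICIENTS CARRIED BY THE LEVEL, the
integral "coefficients at `p`" model [cite: Hida1994AIF, §1]
[cite: AllenCalegariCaraianiGeeEtAl2023, §2.1.2]; as a `Δ`-module construction: the `U`-invariants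
of `Fun(𝒢, V)` under `fnAction`).  All such functions: the coefficient module for COHOMOLOGY
(`cohomology`; by Shapiro `H^i(Γ, M(U,τ)) = ∏_{x ∈ Γ\𝒢/U} H^i(Γ ∩ xUx⁻¹, V)`). -/
abbrev sections : Submodule R (𝒢 → V) :=
  invariants Δ (fnAction Δ τ) U

variable {Δ τ U} in
/-- Membership in `M(U, τ)` for `U ⊆ Δ`: `τ(u) (f (g u)) = f g`. [folklore] -/
theorem mem_sections_iff (hU : U.toSubmonoid ≤ Δ) {f : 𝒢 → V} :
    f ∈ sections Δ τ U ↔ ∀ (g : 𝒢) (u : 𝒢) (hu : u ∈ U), τ ⟨u, hU hu⟩ (f (g * u)) = f g := by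
  refine ⟨fun h g u hu => ?_, fun h u hu => ?_⟩
  · have := congr_fun (h u hu) g
    rwa [act_of_mem (hU hu), fnAction_apply] at this
  · rw [act_of_mem (hU hu)]
    exact funext fun g => h g u hu

/-- The support of `f : 𝒢 → V` modulo `U`: the set of cosets `gU` with `f g ≠ 0`. [folklore] -/
def supportMod (f : 𝒢 → V) : Set (𝒢 ⧸ U) :=
  QuotientGroup.mk '' Function.support f

variable {U} in
/-- `gU ∈ supportMod U f` if `f g ≠ 0`. [folklore] -/
theorem mk_mem_supportMod {f : 𝒢 → V} {g : 𝒢} (h : f g ≠ 0) :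
    (g : 𝒢 ⧸ U) ∈ supportMod U f :=
  ⟨g, h, rfl⟩

/-- Functions `𝒢 → V` whose support is a FINITE union of right `U`-cosets. [folklore] -/
def finiteModLevel : Submodule R (𝒢 → V) where
  carrier := {f | (supportMod U f).Finite}
  zero_mem' := by simp [supportMod]
  add_mem' {f f'} hf hf' :=
    (hf.union hf').subset (by
      rintro _ ⟨g, hg, rfl⟩
      by_contra hc
      simp only [Set.mem_union, not_or] at hc
      apply hg
      have h1 : f g = 0 := by
        by_contra h1; exact hc.1 (mk_mem_supportMod h1)
      have h2 : f' g = 0 := by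
        by_contra h2; exact hc.2 (mk_mem_supportMod h2)
      simp [h1, h2])
  smul_mem' c f hf := hf.subset (Set.image_mono (Function.support_const_smul_subset c f))

variable {U} in
/-- Membership in `finiteModLevel` (definitional). [folklore] -/
theorem mem_finiteModLevel_iff {f : 𝒢 → V} :
    f ∈ finiteModLevel (R := R) U ↔ (supportMod U f).Finite :=
  Iff.rfl

/-- **The finitely supported sections `M_c(U, τ)`**: `U`-equivariant `f : 𝒢 → V` supported on
finitely many cosets `gU` — the compactly induced module `⊕_{x ∈ Γ\𝒢/U} ind (V)` rather than the
coinduced `∏`: the coefficient module for HOMOLOGY (`homology`; by Shapiro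
`H_i(Γ, M_c(U,τ)) = ⊕_{x} H_i(Γ ∩ xUx⁻¹, V)`, the homology of the arithmetic quotient of level `U`
with coefficients in the local system of `τ`). [cite: NewtonThorne2016, §2.1] -/
def compactSections : Submodule R (𝒢 → V) :=
  sections Δ τ U ⊓ finiteModLevel U

variable {Δ τ U} in
/-- Membership in `M_c(U, τ)` (definitional). [folklore] -/
theorem mem_compactSections_iff {f : 𝒢 → V} :
    f ∈ compactSections Δ τ U ↔ f ∈ sections Δ τ U ∧ (supportMod U f).Finite :=
  Iff.rfl

/-! #### The `Γ`-action by left translation -/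

/-- `Γ` acting on `Fun(𝒢, V)` by left translation through `ι`: `(γ · f)(g) = f(ι(γ)⁻¹ g)` (the
group `G(F)` acts on the coefficients-at-`p` local system by left translation ONLY).
[cite: Hida1994AIF, §1] -/
def leftTranslation (R : Type u) [CommRing R] {Γ 𝒢 : Type u} [Group Γ] [Group 𝒢] (ι : Γ →* 𝒢)
    (V : Type u) [AddCommGroup V] [Module R V] : Representation R Γ (𝒢 → V) where
  toFun γ := LinearMap.funLeft R V fun g : 𝒢 => (ι γ)⁻¹ * g
  map_one' := by
    refine LinearMap.ext fun f => funext fun g => ?_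
    simp
  map_mul' γ γ' := by
    refine LinearMap.ext fun f => funext fun g => ?_
    simp [mul_assoc]

/-- Unfolding lemma: `(γ · f)(g) = f (ι(γ)⁻¹ g)`. [folklore] -/
@[simp]
theorem leftTranslation_apply (γ : Γ) (f : 𝒢 → V) (g : 𝒢) :
    leftTranslation R ι V γ f g = f ((ι γ)⁻¹ * g) :=
  rfl

/-- Left translations commute with `act` (left and right multiplication commute). [folklore] -/
theorem act_leftTranslation (x : 𝒢) (γ : Γ) (f : 𝒢 → V) :
    act Δ (fnAction Δ τ) x (leftTranslation R ι V γ f) =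
      leftTranslation R ι V γ (act Δ (fnAction Δ τ) x f) := by
  by_cases hx : x ∈ Δ
  · rw [act_of_mem hx]
    funext g
    simp [mul_assoc]
  · simp [act_of_not_mem hx]

/-- Left translations commute with the Hecke operators on functions. [folklore] -/
theorem heckeOp_leftTranslation (α : 𝒢) (γ : Γ) (f : 𝒢 → V) :
    heckeOp Δ (fnAction Δ τ) U α (leftTranslation R ι V γ f) =
      leftTranslation R ι V γ (heckeOp Δ (fnAction Δ τ) U α f) := by
  classical
  by_cases h : (ArithmeticQuotient.doubleCosetQuot U α).Finite
  · rw [heckeOp_eq_sum h, LinearMap.sum_apply, LinearMap.sum_apply, map_sum]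
    exact Finset.sum_congr rfl fun d _ => act_leftTranslation ι Δ τ d.out γ f
  · rw [heckeOp_eq_zero_of_infinite h, LinearMap.zero_apply, LinearMap.zero_apply, map_zero]

/-- `M(U, τ)` is stable under left translation. [folklore] -/
theorem leftTranslation_mem_sections (γ : Γ) {f : 𝒢 → V} (hf : f ∈ sections Δ τ U) :
    leftTranslation R ι V γ f ∈ sections Δ τ U := fun u hu => by
  rw [act_leftTranslation, hf u hu]

/-- Left translation translates the support modulo `U`. [folklore] -/
theorem supportMod_leftTranslation_subset (γ : Γ) (f : 𝒢 → V) :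
    supportMod U (leftTranslation R ι V γ f) ⊆ (fun c : 𝒢 ⧸ U => ι γ • c) '' supportMod U f := by
  rintro _ ⟨g, hg, rfl⟩
  refine ⟨((ι γ)⁻¹ * g : 𝒢), mk_mem_supportMod hg, ?_⟩
  change ((ι γ * ((ι γ)⁻¹ * g) : 𝒢) : 𝒢 ⧸ U) = _
  rw [mul_inv_cancel_left]

/-- `M_c(U, τ)` is stable under left translation. [folklore] -/
theorem leftTranslation_mem_compactSections (γ : Γ) {f : 𝒢 → V}
    (hf : f ∈ compactSections Δ τ U) : leftTranslation R ι V γ f ∈ compactSections Δ τ U :=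
  ⟨leftTranslation_mem_sections ι Δ τ U γ hf.1,
    (hf.2.image _).subset (supportMod_leftTranslation_subset ι U γ f)⟩

/-- **`M(U, τ)` as a representation of `Γ`** (left translation). [cite: Hida1994AIF, §1] -/
def rep : Representation R Γ (sections Δ τ U) :=
  (leftTranslation R ι V).subrepresentation _ fun γ _ hf =>
    leftTranslation_mem_sections ι Δ τ U γ hf

/-- **`M_c(U, τ)` as a representation of `Γ`** (left translation). [cite: NewtonThorne2016, §2.1] -/
def repC : Representation R Γ (compactSections Δ τ U) :=
  (leftTranslation R ι V).subrepresentation _ fun γ _ hf =>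
    leftTranslation_mem_compactSections ι Δ τ U γ hf

/-- Unfolding lemma for `rep`. [folklore] -/
@[simp]
theorem coe_rep_apply (γ : Γ) (f : sections Δ τ U) :
    (rep ι Δ τ U γ f : 𝒢 → V) = leftTranslation R ι V γ f :=
  rfl

/-- Unfolding lemma for `repC`. [folklore] -/
@[simp]
theorem coe_repC_apply (γ : Γ) (f : compactSections Δ τ U) :
    (repC ι Δ τ U γ f : 𝒢 → V) = leftTranslation R ι V γ f :=
  rfl

/-- **`H^i(U, τ) := H^i(Γ, M(U, τ))`** (Mathlib `groupCohomology`): the cohomology of the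
arithmetic quotient `Γ\(X × 𝒢/U)` of level `U` (as a stack) with coefficients in the local system
of the `U`-module `V` — "coefficients at `p`". [cite: Hida1994AIF, §1]
[cite: AllenCalegariCaraianiGeeEtAl2023, §2.1.2] -/
abbrev cohomology (i : ℕ) : ModuleCat R :=
  groupCohomology (Rep.of (rep ι Δ τ U)) i

/-- **`H_i(U, τ) := H_i(Γ, M_c(U, τ))`** (Mathlib `groupHomology`): the homology of the
arithmetic quotient of level `U` with coefficients in the local system of the `U`-module `V`.
[cite: NewtonThorne2016, §2.1] [cite: AllenCalegariCaraianiGeeEtAl2023, §2.1.2] -/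
abbrev homology (i : ℕ) : ModuleCat R :=
  groupHomology (Rep.of (repC ι Δ τ U)) i

/-! #### Hecke operators on sections and on (co)homology -/

variable {Δ U}

/-- Support of `[UαU] f` modulo `U`: contained in the translates `s̃ • (Uα⁻¹U/U)` of the inverse
double coset by the (finitely many) cosets `s` in the support of `f`. [folklore] -/
theorem supportMod_heckeOp_subset (hU : U.toSubmonoid ≤ Δ) {α : 𝒢} (hα : α ∈ Δ) (f : 𝒢 → V) :
    supportMod U (heckeOp Δ (fnAction Δ τ) U α f) ⊆
      ⋃ s ∈ supportMod U f, (fun e : 𝒢 ⧸ U => s.out • e) ''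
        ArithmeticQuotient.doubleCosetQuot U α⁻¹ := by
  classical
  rintro _ ⟨x, hx, rfl⟩
  by_cases h : (ArithmeticQuotient.doubleCosetQuot U α).Finite
  swap
  · exact absurd (by rw [heckeOp_eq_zero_of_infinite h]; rfl) hx
  rw [Function.mem_support, heckeOp_eq_sum h, LinearMap.sum_apply, Finset.sum_apply] at hx
  obtain ⟨d, hd, hdx⟩ := Finset.exists_ne_zero_of_sum_ne_zero hx
  rw [Set.Finite.mem_toFinset] at hd
  have hdΔ : d.out ∈ Δ := out_mem_of_mem_doubleCosetQuot hU hα hd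
  rw [act_of_mem hdΔ, fnAction_apply] at hdx
  have hfx : f (x * d.out) ≠ 0 := fun h0 => hdx (by rw [h0, map_zero])
  refine Set.mem_iUnion₂.2 ⟨(x * d.out : 𝒢), mk_mem_supportMod hfx, ?_⟩
  obtain ⟨u, hu⟩ := QuotientGroup.mk_out_eq_mul U (x * d.out)
  refine ⟨(((u : 𝒢)⁻¹ * d.out⁻¹ : 𝒢) : 𝒢 ⧸ U), ?_, ?_⟩
  · -- `u⁻¹ d̃⁻¹ U ∈ U α⁻¹ U / U`
    obtain ⟨u₁, hu₁, hd₁⟩ := exists_mk_eq_of_mem_doubleCosetQuot hd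
    obtain ⟨u₂, hu₂⟩ := QuotientGroup.mk_out_eq_mul U (u₁ * α)
    rw [hd₁] at hu₂
    refine ⟨⟨(u : 𝒢)⁻¹ * (u₂ : 𝒢)⁻¹, U.mul_mem (U.inv_mem u.2) (U.inv_mem u₂.2)⟩, ?_⟩
    change (((u : 𝒢)⁻¹ * (u₂ : 𝒢)⁻¹) • ((α⁻¹ : 𝒢) : 𝒢 ⧸ U)) = _
    rw [MulAction.Quotient.smul_coe, smul_eq_mul, hu₂, QuotientGroup.eq]
    simp [mul_assoc, hu₁]
  · change ((((x * d.out : 𝒢) : 𝒢 ⧸ U).out • ((((u : 𝒢)⁻¹ * d.out⁻¹ : 𝒢)) : 𝒢 ⧸ U)) = (x : 𝒢 ⧸ U))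
    rw [MulAction.Quotient.smul_coe, smul_eq_mul, hu]
    congr 1
    group

/-- `[UαU]` preserves `M_c(U, τ)` when `Uα⁻¹U/U` is finite (always, for a Hecke pair). [folklore] -/
theorem heckeOp_apply_mem_compactSections (hU : U.toSubmonoid ≤ Δ) {α : 𝒢} (hα : α ∈ Δ)
    (hfin : (ArithmeticQuotient.doubleCosetQuot U α⁻¹).Finite) {f : 𝒢 → V}
    (hf : f ∈ compactSections Δ τ U) :
    heckeOp Δ (fnAction Δ τ) U α f ∈ compactSections Δ τ U :=
  ⟨heckeOp_apply_mem hU hα hf.1,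
    (hf.2.biUnion fun _ _ => hfin.image _).subset (supportMod_heckeOp_subset τ hU hα f)⟩

variable (Δ U)

/-- **`[UαU]` as an endomorphism of the `Γ`-representation `M(U, τ)`** (`α ∈ Δ ⊇ U`).
[cite: NewtonThorne2016, §2.2.1 Lemma 2.3] -/
def heckeRepHom (hU : U.toSubmonoid ≤ Δ) {α : 𝒢} (hα : α ∈ Δ) :
    Rep.of (rep ι Δ τ U) ⟶ Rep.of (rep ι Δ τ U) :=
  Rep.ofHom ⟨heckeOpInv hU hα, fun γ => LinearMap.ext fun f => Subtype.ext (by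
    simp only [LinearMap.coe_comp, Function.comp_apply, coe_heckeOpInv_apply, coe_rep_apply]
    exact heckeOp_leftTranslation ι Δ τ U α γ f)⟩

/-- **`[UαU]` as an endomorphism of the `Γ`-representation `M_c(U, τ)`** for a Hecke pair
(`[IsHeckeTriple ⊤ U U]`: all `UgU/U` finite). [cite: NewtonThorne2016, §2.2.1 Lemma 2.3] -/
def heckeRepHomC [IsHeckeTriple (⊤ : Submonoid 𝒢) U U] (hU : U.toSubmonoid ≤ Δ) {α : 𝒢}
    (hα : α ∈ Δ) : Rep.of (repC ι Δ τ U) ⟶ Rep.of (repC ι Δ τ U) :=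
  Rep.ofHom ⟨(heckeOp Δ (fnAction Δ τ) U α).restrict fun _ hf =>
      heckeOp_apply_mem_compactSections τ hU hα (finite_orbit_quotient U α⁻¹) hf,
    fun γ => LinearMap.ext fun f => Subtype.ext (by
      simp only [LinearMap.coe_comp, Function.comp_apply, LinearMap.coe_restrict_apply,
        coe_repC_apply]
      exact heckeOp_leftTranslation ι Δ τ U α γ f)⟩

/-- Unfolding lemma for `heckeRepHom`. [folklore] -/
@[simp]
theorem heckeRepHom_hom_apply_coe (hU : U.toSubmonoid ≤ Δ) {α : 𝒢} (hα : α ∈ Δ)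
    (f : sections Δ τ U) :
    ((heckeRepHom ι Δ τ U hU hα).hom f : 𝒢 → V) = heckeOp Δ (fnAction Δ τ) U α f :=
  rfl

/-- Unfolding lemma for `heckeRepHomC`. [folklore] -/
@[simp]
theorem heckeRepHomC_hom_apply_coe [IsHeckeTriple (⊤ : Submonoid 𝒢) U U]
    (hU : U.toSubmonoid ≤ Δ) {α : 𝒢} (hα : α ∈ Δ) (f : compactSections Δ τ U) :
    ((heckeRepHomC ι Δ τ U hU hα).hom f : 𝒢 → V) = heckeOp Δ (fnAction Δ τ) U α f :=
  rfl

/-- **The Hecke operator `[UαU]` on `H^i(U, τ)`** (functoriality of group cohomology in the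
coefficients). [cite: AllenCalegariCaraianiGeeEtAl2023, §2.1.2–§2.1.3] -/
abbrev heckeCohomology (hU : U.toSubmonoid ≤ Δ) {α : 𝒢} (hα : α ∈ Δ) (i : ℕ) :
    Module.End R (cohomology ι Δ τ U i) :=
  (groupCohomology.map (MonoidHom.id Γ) (heckeRepHom ι Δ τ U hU hα) i).hom

/-- **The Hecke operator `[UαU]` on `H_i(U, τ)`** (functoriality of group homology in the
coefficients). [cite: AllenCalegariCaraianiGeeEtAl2023, §2.1.2–§2.1.3] -/
abbrev heckeHomology [IsHeckeTriple (⊤ : Submonoid 𝒢) U U] (hU : U.toSubmonoid ≤ Δ) {α : 𝒢}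
    (hα : α ∈ Δ) (i : ℕ) : Module.End R (homology ι Δ τ U i) :=
  (groupHomology.map (MonoidHom.id Γ) (heckeRepHomC ι Δ τ U hU hα) i).hom

variable {Δ U}

/-- Commuting Hecke operators on `M(U,τ)` give commuting operators on `H^i(U, τ)`. [folklore] -/
theorem heckeCohomology_comm (hU : U.toSubmonoid ≤ Δ) {α β : 𝒢} (hα : α ∈ Δ) (hβ : β ∈ Δ)
    (h : ∀ f ∈ sections Δ τ U, heckeOp Δ (fnAction Δ τ) U α (heckeOp Δ (fnAction Δ τ) U β f) =
      heckeOp Δ (fnAction Δ τ) U β (heckeOp Δ (fnAction Δ τ) U α f)) (i : ℕ) :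
    heckeCohomology ι Δ τ U hU hα i * heckeCohomology ι Δ τ U hU hβ i =
      heckeCohomology ι Δ τ U hU hβ i * heckeCohomology ι Δ τ U hU hα i := by
  have hrep : heckeRepHom ι Δ τ U hU hβ ≫ heckeRepHom ι Δ τ U hU hα =
      heckeRepHom ι Δ τ U hU hα ≫ heckeRepHom ι Δ τ U hU hβ :=
    Rep.hom_ext (Representation.IntertwiningMap.ext (LinearMap.ext fun f =>
      Subtype.ext (h f f.2)))
  dsimp only [heckeCohomology]
  rw [Module.End.mul_eq_comp, Module.End.mul_eq_comp, ← ModuleCat.hom_comp, ← ModuleCat.hom_comp,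
    ← groupCohomology.map_id_comp, ← groupCohomology.map_id_comp, hrep]

/-- Commuting Hecke operators on `M_c(U,τ)` give commuting operators on `H_i(U, τ)`. [folklore] -/
theorem heckeHomology_comm [IsHeckeTriple (⊤ : Submonoid 𝒢) U U] (hU : U.toSubmonoid ≤ Δ)
    {α β : 𝒢} (hα : α ∈ Δ) (hβ : β ∈ Δ)
    (h : ∀ f ∈ compactSections Δ τ U,
      heckeOp Δ (fnAction Δ τ) U α (heckeOp Δ (fnAction Δ τ) U β f) =
        heckeOp Δ (fnAction Δ τ) U β (heckeOp Δ (fnAction Δ τ) U α f)) (i : ℕ) :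
    heckeHomology ι Δ τ U hU hα i * heckeHomology ι Δ τ U hU hβ i =
      heckeHomology ι Δ τ U hU hβ i * heckeHomology ι Δ τ U hU hα i := by
  have hrep : heckeRepHomC ι Δ τ U hU hβ ≫ heckeRepHomC ι Δ τ U hU hα =
      heckeRepHomC ι Δ τ U hU hα ≫ heckeRepHomC ι Δ τ U hU hβ :=
    Rep.hom_ext (Representation.IntertwiningMap.ext (LinearMap.ext fun f =>
      Subtype.ext (h f f.2)))
  dsimp only [heckeHomology]
  rw [Module.End.mul_eq_comp, Module.End.mul_eq_comp, ← ModuleCat.hom_comp, ← ModuleCat.hom_comp,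
    ← groupHomology.map_id_comp, ← groupHomology.map_id_comp, hrep]

/-! #### Comparison with coefficients carried by `Γ` ("coefficients at `∞`") -/

section Comparison

variable (U) (σ : Representation R 𝒢 V)

/-- The comparison map `Φ f (gU) = σ(g̃) (f g̃)` (`g̃ = (gU).out`) from `V`-valued functions on `𝒢`
to `V`-valued functions on `𝒢 ⧸ U`, used when the level action `τ` is the restriction of an action
`σ` of all of `𝒢` on `V` (e.g. `V = V_λ(K_p)`, on which `GL₂(K_p)` acts): it carries the
coefficients-at-`p` model `M(U, σ|_Δ)` to the coefficients-at-`∞` model `Fun(𝒢 ⧸ U, V)` with the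
`Γ`-action `(γ F)(c) = σ(ιγ) F(ι(γ)⁻¹ c)` (`TwistedQuotient.coeffRepresentation ι U (σ ∘ ι)` of
`CuspidalCohomologyGL`), cf. `toLevelFunctions_leftTranslation`.
[cite: Hida1994AIF, §1] -/
def toLevelFunctions : (𝒢 → V) →ₗ[R] ((𝒢 ⧸ U) → V) where
  toFun f c := σ c.out (f c.out)
  map_add' f f' := funext fun c => by simp
  map_smul' r f := funext fun c => by simp

variable {τ U σ}

/-- On sections, `Φ f (gU) = σ(g) (f g)` for EVERY representative `g`. [folklore] -/
theorem toLevelFunctions_apply_mk (hστ : ∀ δ : Δ, τ δ = σ δ) (hU : U.toSubmonoid ≤ Δ)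
    {f : 𝒢 → V} (hf : f ∈ sections Δ τ U) (g : 𝒢) :
    toLevelFunctions U σ f (g : 𝒢 ⧸ U) = σ g (f g) := by
  obtain ⟨u, hu⟩ := QuotientGroup.mk_out_eq_mul U g
  change σ ((g : 𝒢 ⧸ U).out) (f (g : 𝒢 ⧸ U).out) = _
  rw [hu, map_mul, Module.End.mul_apply]
  congr 1
  have h := (mem_sections_iff hU).1 hf g u u.2
  rwa [hστ] at h

/-- **`Φ` is `Γ`-equivariant** from left translation to the twisted action
`(γ F)(c) = σ(ιγ) F(ι(γ)⁻¹ c)`. [folklore] -/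
theorem toLevelFunctions_leftTranslation (hστ : ∀ δ : Δ, τ δ = σ δ) (hU : U.toSubmonoid ≤ Δ)
    {f : 𝒢 → V} (hf : f ∈ sections Δ τ U) (γ : Γ) (c : 𝒢 ⧸ U) :
    toLevelFunctions U σ (leftTranslation R ι V γ f) c =
      σ (ι γ) (toLevelFunctions U σ f ((ι γ)⁻¹ • c)) := by
  induction c using QuotientGroup.induction_on with
  | H g =>
    rw [toLevelFunctions_apply_mk hστ hU (leftTranslation_mem_sections ι Δ τ U γ hf),
      leftTranslation_apply, MulAction.Quotient.smul_coe, smul_eq_mul,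
      toLevelFunctions_apply_mk hστ hU hf, ← Module.End.mul_apply, ← map_mul, mul_inv_cancel_left]

/-- The inverse comparison map `Ψ F (g) = σ(g)⁻¹ F(gU)` lands in the sections. [folklore] -/
theorem comp_mk_mem_sections (hστ : ∀ δ : Δ, τ δ = σ δ) (hU : U.toSubmonoid ≤ Δ)
    (F : (𝒢 ⧸ U) → V) : (fun g : 𝒢 => σ g⁻¹ (F (g : 𝒢 ⧸ U))) ∈ sections Δ τ U := by
  refine (mem_sections_iff hU).2 fun g u hu => ?_
  rw [hστ, QuotientGroup.mk_mul_of_mem g hu]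
  change (σ u * σ (g * u)⁻¹) (F (g : 𝒢 ⧸ U)) = _
  rw [← map_mul, mul_inv_rev, mul_inv_cancel_left]

variable (τ U σ) in
/-- **The comparison isomorphism of coefficient modules** `M(U, σ|_Δ) ≃ Fun(𝒢 ⧸ U, V)`,
`f ↦ (gU ↦ σ(g) f(g))`, with inverse `F ↦ (g ↦ σ(g)⁻¹ F(gU))`: for coefficients on which all of
`𝒢` acts (`V_λ(K_p)`, i.e. after `⊗ ℚ_p` on the coefficients) the "at `p`" and "at `∞`" models
are isomorphic `Γ`-equivariantly (`toLevelFunctions_leftTranslation`), hence so are their group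
(co)homologies by functoriality.  (The INTEGRAL statement `H(U, V_λ(𝒪)) ⊗ ℚ_p ≅ H(U, V_λ(K_p))`
additionally needs flat base change for group (co)homology, not formalised here.)
[cite: Hida1994AIF, §1] [cite: AllenCalegariCaraianiGeeEtAl2023, §2.1.2] -/
def sectionsEquivLevelFunctions (hστ : ∀ δ : Δ, τ δ = σ δ) (hU : U.toSubmonoid ≤ Δ) :
    sections Δ τ U ≃ₗ[R] ((𝒢 ⧸ U) → V) where
  toFun f := toLevelFunctions U σ f
  map_add' f f' := map_add _ _ _
  map_smul' r f := map_smul _ _ _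
  invFun F := ⟨fun g => σ g⁻¹ (F (g : 𝒢 ⧸ U)), comp_mk_mem_sections hστ hU F⟩
  left_inv f := Subtype.ext (funext fun g => by
    change σ g⁻¹ (toLevelFunctions U σ (f : 𝒢 → V) (g : 𝒢 ⧸ U)) = (f : 𝒢 → V) g
    rw [toLevelFunctions_apply_mk hστ hU f.2, ← Module.End.mul_apply, ← map_mul, inv_mul_cancel,
      map_one, Module.End.one_apply])
  right_inv F := funext fun c => by
    induction c using QuotientGroup.induction_on with
    | H g =>
      change toLevelFunctions U σ (fun g => σ g⁻¹ (F (g : 𝒢 ⧸ U))) (g : 𝒢 ⧸ U) = F g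
      rw [toLevelFunctions_apply_mk hστ hU (comp_mk_mem_sections hστ hU F), ← Module.End.mul_apply,
        ← map_mul, mul_inv_cancel, map_one, Module.End.one_apply]

/-- Unfolding lemma for `sectionsEquivLevelFunctions`. [folklore] -/
@[simp]
theorem sectionsEquivLevelFunctions_apply (hστ : ∀ δ : Δ, τ δ = σ δ) (hU : U.toSubmonoid ≤ Δ)
    (f : sections Δ τ U) :
    sectionsEquivLevelFunctions τ U σ hστ hU f = toLevelFunctions U σ f :=
  rfl

end Comparison

end Functions

end LevelAction

/-! ### (C) `GL₂` over a number field: `V_λ(𝒪) = ⊗ⱼ Sym^{kⱼ}(𝒪²)` carried by the level at `p` -/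

namespace IntegralWeightGL2

open BigHeckeGLn IsDedekindDomain
open scoped _root_.NumberField _root_.TensorProduct

/-! #### Integral matrices at a finite place -/

section IntegralMatrices

variable (K : Type) [Field K] [NumberField K] (n : ℕ) (v : HeightOneSpectrum (𝓞 K))

/-- The submonoid `M_n(𝒪_v) ∩ GL_n(K_v)` of `GL_n(K_v)`: invertible matrices with INTEGRAL entries
(inverse not required integral) — the local Hecke monoid through which integral coefficient
modules are acted on (it contains `GL_n(𝒪_v)` and the Hecke elements `diag(ϖ_v^{a₁}, …)`, `aᵢ ≥ 0`).
[cite: Hida1994AIF, §1 (1.7)] -/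
def integralAt : Submonoid (GL (Fin n) (v.adicCompletion K)) where
  carrier := {g | ∀ i j, (g : Matrix (Fin n) (Fin n) (v.adicCompletion K)) i j ∈
    v.adicCompletionIntegers K}
  one_mem' i j := by
    rw [Units.val_one, Matrix.one_apply]
    split_ifs
    · exact one_mem _
    · exact zero_mem _
  mul_mem' {a b} ha hb i j := by
    rw [Units.val_mul, Matrix.mul_apply]
    exact sum_mem fun k _ => mul_mem (ha i k) (hb k j)

variable {K n v} in
/-- Membership in `integralAt` (definitional). [folklore] -/
theorem mem_integralAt_iff {g : GL (Fin n) (v.adicCompletion K)} :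
    g ∈ integralAt K n v ↔
      ∀ i j, (g : Matrix (Fin n) (Fin n) (v.adicCompletion K)) i j ∈ v.adicCompletionIntegers K :=
  Iff.rfl

/-- `GL_n(𝒪_v) ⊆ M_n(𝒪_v) ∩ GL_n(K_v)`. [folklore] -/
theorem valuedCongruenceSubgroup_one_le_integralAt :
    (valuedCongruenceSubgroup (F := v.adicCompletion K) (Fin n)
        (1 : WithZero (Multiplicative ℤ))).toSubmonoid ≤ integralAt K n v :=
  fun _ hg i j => (HeightOneSpectrum.mem_adicCompletionIntegers (R := 𝓞 K) K v).2
    ((mem_valuedCongruenceSubgroup_iff.1 hg).1 i j)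

/-- The integral matrix underlying an element of `M_n(𝒪_v) ∩ GL_n(K_v)`, multiplicatively.
[folklore] -/
def toIntMatrix : integralAt K n v →* Matrix (Fin n) (Fin n) (v.adicCompletionIntegers K) where
  toFun g := Matrix.of fun i j =>
    ⟨((g : GL (Fin n) (v.adicCompletion K)) : Matrix (Fin n) (Fin n) (v.adicCompletion K)) i j,
      g.2 i j⟩
  map_one' := by
    refine Matrix.ext fun i j => Subtype.ext ?_
    change ((1 : GL (Fin n) (v.adicCompletion K)) : Matrix (Fin n) (Fin n) (v.adicCompletion K))
      i j = (((1 : Matrix (Fin n) (Fin n) (v.adicCompletionIntegers K)) i j :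
        v.adicCompletionIntegers K) : v.adicCompletion K)
    rw [Units.val_one, Matrix.one_apply, Matrix.one_apply]
    split_ifs <;> rfl
  map_mul' a b := by
    refine Matrix.ext fun i j => Subtype.ext ?_
    change ((a * b : GL (Fin n) (v.adicCompletion K)) : Matrix (Fin n) (Fin n) (v.adicCompletion K))
      i j = (((Matrix.of _ * Matrix.of _ :
        Matrix (Fin n) (Fin n) (v.adicCompletionIntegers K)) i j : v.adicCompletionIntegers K) :
          v.adicCompletion K)
    rw [Units.val_mul, Matrix.mul_apply, Matrix.mul_apply]
    push_cast
    rfl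

variable {K n v} in
/-- Entries of `toIntMatrix g` are the entries of `g`. [folklore] -/
@[simp]
theorem coe_toIntMatrix_apply (g : integralAt K n v) (i j : Fin n) :
    ((toIntMatrix K n v g i j : v.adicCompletionIntegers K) : v.adicCompletion K) =
      ((g : GL (Fin n) (v.adicCompletion K)) : Matrix (Fin n) (Fin n) (v.adicCompletion K)) i j :=
  rfl

/-- The fixed uniformiser `ϖ_v` (`BigHeckeGLn.uniformizerAt`) is integral. [folklore] -/
theorem uniformizerAt_mem_adicCompletionIntegers :
    ((uniformizerAt v : (v.adicCompletion K)ˣ) : v.adicCompletion K) ∈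
      v.adicCompletionIntegers K := by
  rw [HeightOneSpectrum.mem_adicCompletionIntegers]
  change Valued.v ((Classical.choose (v.valuation_exists_uniformizer K) : K) :
    v.adicCompletion K) ≤ 1
  rw [HeightOneSpectrum.valuedAdicCompletion_eq_valuation',
    Classical.choose_spec (v.valuation_exists_uniformizer K), ← WithZero.exp_zero]
  exact WithZero.exp_le_exp.2 (by norm_num)

/-- The local Hecke element `diag(ϖ_v,…,ϖ_v,1,…,1)` is integral. [folklore] -/
theorem glDiagonal_uniformizerAt_mem_integralAt (i : ℕ) :
    glDiagonal n (v.adicCompletion K) (fun l => if l.val < i then uniformizerAt v else 1) ∈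
      integralAt K n v := by
  intro a b
  rw [coe_glDiagonal, Matrix.diagonal_apply]
  split_ifs
  · exact uniformizerAt_mem_adicCompletionIntegers K v
  · rw [Units.val_one]
    exact one_mem _
  · exact zero_mem _

/-- The scalar Hecke element `t_{v,n} = diag(ϖ_v,…,ϖ_v)` (identity away from `v`) is CENTRAL in
`GL_n(𝔸_K^∞)`. [folklore] -/
theorem mul_heckeElement_self_comm (g : FiniteAdelicGL n K) :
    g * heckeElement n K v n = heckeElement n K v n * g := by
  rw [heckeElement_eq_ofLocal]
  refine ext_localComponent fun w => ?_
  rw [map_mul, map_mul]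
  by_cases hw : w = v
  · subst hw
    rw [localComponent_ofLocal]
    refine Matrix.GeneralLinearGroup.ext fun a b => ?_
    have hdiag : (glDiagonal n (w.adicCompletion K) (fun l : Fin n =>
        if l.val < n then uniformizerAt w else 1) : Matrix (Fin n) (Fin n) (w.adicCompletion K)) =
        ((uniformizerAt w : (w.adicCompletion K)ˣ) : w.adicCompletion K) •
          (1 : Matrix (Fin n) (Fin n) (w.adicCompletion K)) := by
      rw [coe_glDiagonal, Matrix.smul_one_eq_diagonal]
      congr 1
      funext l
      rw [if_pos l.isLt]
    rw [Matrix.GeneralLinearGroup.coe_mul, Matrix.GeneralLinearGroup.coe_mul, hdiag,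
      Matrix.mul_smul, Matrix.smul_mul, Matrix.mul_one, Matrix.one_mul]
  · rw [localComponent_ofLocal_of_ne hw, mul_one, one_mul]

end IntegralMatrices

/-! #### `Sym^m(𝒪²)` with its integral `M₂(𝒪)`-action -/

section SymPow

variable (𝒪 : Type) [CommRing 𝒪]

/-- **`Sym^m(𝒪²)`**, realised as the free `𝒪`-module of homogeneous forms of degree `m` in two
variables `X₀, X₁` (Mathlib `MvPolynomial.homogeneousSubmodule`; the degree-one forms are the
standard representation `X_i ↦ ∑_j A_{ji} X_j` of `linSubst`, so degree `m` is its `m`-th symmetric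
power, highest weight `(m, 0)` with highest-weight vector `X₀^m`) — Hida's `L(n; A)`.
[cite: Hida1994AIF, §1] -/
abbrev SymPow (m : ℕ) : Type :=
  ↥(MvPolynomial.homogeneousSubmodule (Fin 2) 𝒪 m)

open Literature.Computability.AlgebraicComplexity in
/-- **The INTEGRAL action of the matrix monoid `M₂(𝒪)` on `Sym^m(𝒪²)`** by linear substitution
of variables (the tree's `linSubstMonoidHom`, restricted to forms of degree `m`): defined for ALL
matrices, invertible or not, hence for the images of `diag(ϖ_v, 1)` etc. — on `X₀^a X₁^{m−a}` the
matrix `diag(ϖ, 1)` acts by `ϖ^a`.  For `λ_v = (m, 0)` this is the `p`-integrally normalised action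
`·_p` of [cite: AllenCalegariCaraianiGeeEtAl2023, §2.2.2] on the monoid
`⊔_{a ≥ b} Iw diag(ϖ^a, ϖ^b) Iw`, up to the scalar `τ(ϖ)^{b m}` (`= 1` at `diag(ϖ,1)`). -/
def symPowAction (m : ℕ) : Matrix (Fin 2) (Fin 2) 𝒪 →* Module.End 𝒪 (SymPow 𝒪 m) where
  toFun A := (linSubst (Fin 2) 𝒪 A).toLinearMap.restrict
    fun _ hf => linSubst_mem_homogeneousSubmodule A hf
  map_one' := LinearMap.ext fun f => Subtype.ext (by simp [linSubst_one])
  map_mul' A B := LinearMap.ext fun f => Subtype.ext (by simp [linSubst_mul])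

open Literature.Computability.AlgebraicComplexity in
/-- Unfolding lemma: `symPowAction` is linear substitution. [folklore] -/
@[simp]
theorem coe_symPowAction_apply (m : ℕ) (A : Matrix (Fin 2) (Fin 2) 𝒪) (f : SymPow 𝒪 m) :
    ((symPowAction 𝒪 m A f : SymPow 𝒪 m) : MvPolynomial (Fin 2) 𝒪) = linSubst (Fin 2) 𝒪 A f :=
  rfl

open Literature.Computability.AlgebraicComplexity MvPolynomial in
/-- **The diagonal matrix `diag(d₀, d₁)` acts on the monomial `X₀^a X₁^b` by `d₀^a d₁^b`**; in
particular `diag(ϖ, 1)` acts on `Sym^m` by `ϖ^a` on `X₀^a X₁^{m−a}` — integral, with eigenvalue `1`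
on `X₁^m`: the `p`-integral normalisation of `U_v`. [folklore] -/
theorem linSubst_diagonal_monomial (d : Fin 2 → 𝒪) (a b : ℕ) :
    linSubst (Fin 2) 𝒪 (Matrix.diagonal d) (X 0 ^ a * X 1 ^ b) =
      (d 0 ^ a * d 1 ^ b) • (X 0 ^ a * X 1 ^ b : MvPolynomial (Fin 2) 𝒪) := by
  have hX : ∀ i : Fin 2, linSubst (Fin 2) 𝒪 (Matrix.diagonal d) (X i) = d i • X i := by
    intro i
    fin_cases i <;> simp [Matrix.diagonal]
  rw [map_mul, map_pow, map_pow, hX, hX, smul_pow, smul_pow, smul_mul_smul_comm]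

end SymPow

/-! #### Integral weights and the coefficient module `V_λ(𝒪)` -/

/-- **An integral weight datum `λ` for `GL₂` over `K` with coefficients in `𝒪`**: a family,
indexed by `j ∈ J` (intended: the embeddings `τ : K ↪ E` of a `p`-adic field `E ⊇` all `K_v`,
`v ∣ p`, with `𝒪 = 𝒪_E`; for `K` imaginary quadratic and `p` split, `J = {v, v̄}` and `𝒪 = ℤ_p`),
of a finite place `place j` (the place `v(τ)` above `p`), a ring homomorphism
`emb j : 𝒪_{place j} → 𝒪` (the embedding `τ`) and a degree `deg j = k_j ≥ 0`; it defines
`V_λ(𝒪) = ⊗_j Sym^{k_j}(𝒪²)` with `g ∈ GL₂(𝒪_{K,p})` acting on the `j`-th factor through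
`emb j (g_{place j})`.  Determinant twists `det^{w_j}` are NOT included
(`-- TODO(general form): λ_j = (k_j + w_j, w_j)`, and `GL_n` via integral Weyl modules).
[cite: AllenCalegariCaraianiGeeEtAl2023, §2.2.1] [cite: Hida1994AIF, §1] -/
structure IntegralWeight (K : Type) [Field K] [NumberField K] (𝒪 : Type) [CommRing 𝒪]
    (J : Type) where
  /-- the place carrying the `j`-th tensor factor -/
  place : J → HeightOneSpectrum (𝓞 K)
  /-- the embedding `𝒪_{place j} → 𝒪` through which the `j`-th factor is acted on -/
  emb : ∀ j, (place j).adicCompletionIntegers K →+* 𝒪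
  /-- the degree `k_j` of the symmetric power at `j` -/
  deg : J → ℕ

namespace IntegralWeight

variable {K : Type} [Field K] [NumberField K] {𝒪 : Type} [CommRing 𝒪] {J : Type}

/-- The weight `Sym^k` at a single place `v` with coefficients `𝒪 = 𝒪_v` (`J = Unit`, `emb = id`):
e.g. `K` imaginary quadratic, `p = v` inert, or the factor at one `v ∣ p`. [folklore] -/
def single (v : HeightOneSpectrum (𝓞 K)) (k : ℕ) :
    IntegralWeight K (v.adicCompletionIntegers K) Unit where
  place _ := v
  emb _ := RingHom.id _
  deg _ := k

variable (𝓥 : IntegralWeight K 𝒪 J)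

/-- **The coefficient module `V_λ(𝒪) = ⊗_{j} Sym^{k_j}(𝒪²)`** (Mathlib `PiTensorProduct` over `𝒪`).
A `def` carrying its own `AddCommGroup`/`Module` instances (one instance path for everything built
on it, as for `GLnCohomology.CoeffModule`). [cite: AllenCalegariCaraianiGeeEtAl2023, §2.2.1] -/
def CoeffModule : Type :=
  ⨂[𝒪] j : J, SymPow 𝒪 (𝓥.deg j)

/-- `V_λ(𝒪)` is an additive group (that of the tensor product). [folklore] -/
instance : AddCommGroup 𝓥.CoeffModule :=
  inferInstanceAs (AddCommGroup (⨂[𝒪] j : J, SymPow 𝒪 (𝓥.deg j)))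

/-- `V_λ(𝒪)` is an `𝒪`-module (that of the tensor product). [folklore] -/
instance : Module 𝒪 𝓥.CoeffModule :=
  inferInstanceAs (Module 𝒪 (⨂[𝒪] j : J, SymPow 𝒪 (𝓥.deg j)))

/-- Pure tensors `⊗_j x_j ∈ V_λ(𝒪)` (`PiTensorProduct.tprod`). [folklore] -/
def tprod (x : ∀ j, SymPow 𝒪 (𝓥.deg j)) : 𝓥.CoeffModule :=
  PiTensorProduct.tprod 𝒪 x

/-- **The Hecke monoid `Δ_λ ≤ GL₂(𝔸_K^∞)` of `λ`**: finite-adelic matrices whose components at the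
places of `λ` are integral (no condition elsewhere) — it contains every level `U ≤ GL₂(𝒪̂_K)`,
every Hecke element `t_{w,i}`, and `GL₂(K_w)` (embedded at `w`) for `w` not a place of `λ`.
[cite: AllenCalegariCaraianiGeeEtAl2023, §2.2.2] [cite: Hida1994AIF, §1 (1.7)] -/
def heckeMonoid : Submonoid (FiniteAdelicGL 2 K) :=
  ⨅ j, (integralAt K 2 (𝓥.place j)).comap (localComponent 2 K (𝓥.place j))

/-- Membership in `Δ_λ`: the components at the places of `λ` are integral. [folklore] -/
theorem mem_heckeMonoid_iff {g : FiniteAdelicGL 2 K} :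
    g ∈ 𝓥.heckeMonoid ↔ ∀ j, localComponent 2 K (𝓥.place j) g ∈ integralAt K 2 (𝓥.place j) := by
  simp only [heckeMonoid, Submonoid.mem_iInf, Submonoid.mem_comap]

/-- The `j`-th local component of an element of `Δ_λ`, an integral matrix at `place j`.
[folklore] -/
def localFactor (j : J) : 𝓥.heckeMonoid →* integralAt K 2 (𝓥.place j) :=
  ((localComponent 2 K (𝓥.place j)).submonoidComap (integralAt K 2 (𝓥.place j))).comp
    (Submonoid.inclusion (iInf_le _ j))

/-- Unfolding lemma for `localFactor`. [folklore] -/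
@[simp]
theorem coe_localFactor (j : J) (g : 𝓥.heckeMonoid) :
    (𝓥.localFactor j g : GL (Fin 2) ((𝓥.place j).adicCompletion K)) =
      localComponent 2 K (𝓥.place j) g :=
  rfl

/-- **The integral action `τ_λ` of `Δ_λ` on `V_λ(𝒪)`**: `g` acts on the `j`-th factor
`Sym^{k_j}(𝒪²)` through the integral matrix `emb j (g_{place j}) ∈ M₂(𝒪)` (`symPowAction`), and on
the tensor product factorwise (`PiTensorProduct.map`). On a level `U ≤ GL₂(𝒪̂_K)` this is the
`𝒪[∏_{v∣p} GL₂(𝒪_v)]`-module structure of `𝒱_λ`; on `diag(ϖ_v, 1)` it is the `p`-integral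
(renormalised) action defining `U_v`. [cite: AllenCalegariCaraianiGeeEtAl2023, §2.2.1–§2.2.2] -/
def coeffAction : 𝓥.heckeMonoid →* Module.End 𝒪 𝓥.CoeffModule :=
  show 𝓥.heckeMonoid →* Module.End 𝒪 (⨂[𝒪] j : J, SymPow 𝒪 (𝓥.deg j)) from
    PiTensorProduct.mapMonoidHom.comp (MonoidHom.pi fun j =>
      (symPowAction 𝒪 (𝓥.deg j)).comp ((𝓥.emb j).mapMatrix.toMonoidHom.comp
        ((toIntMatrix K 2 (𝓥.place j)).comp (𝓥.localFactor j))))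

/-- `τ_λ(g)` on pure tensors: factorwise linear substitution by `emb j (g_{place j})`. [folklore] -/
theorem coeffAction_apply_tprod (g : 𝓥.heckeMonoid) (x : ∀ j, SymPow 𝒪 (𝓥.deg j)) :
    𝓥.coeffAction g (𝓥.tprod x) = 𝓥.tprod fun j =>
      symPowAction 𝒪 (𝓥.deg j)
        ((𝓥.emb j).mapMatrix (toIntMatrix K 2 (𝓥.place j) (𝓥.localFactor j g))) (x j) :=
  PiTensorProduct.map_tprod _ _

/-! #### Levels and Hecke elements lie in `Δ_λ` -/

/-- A level `U ≤ GL₂(𝒪̂_K)` is contained in `Δ_λ`. [folklore] -/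
theorem le_heckeMonoid {U : Subgroup (FiniteAdelicGL 2 K)} (hU : U ≤ glFiniteIntegralLevel 2 K) :
    U.toSubmonoid ≤ 𝓥.heckeMonoid := fun _ hu =>
  𝓥.mem_heckeMonoid_iff.2 fun j => valuedCongruenceSubgroup_one_le_integralAt K 2 (𝓥.place j)
    (localComponent_mem_valuedCongruenceSubgroup_one (hU hu) _)

/-- Every Hecke element `t_{w,i}` lies in `Δ_λ`. [folklore] -/
theorem heckeElement_mem_heckeMonoid (w : HeightOneSpectrum (𝓞 K)) (i : ℕ) :
    heckeElement 2 K w i ∈ 𝓥.heckeMonoid := by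
  rw [mem_heckeMonoid_iff]
  intro j
  rw [heckeElement_eq_ofLocal]
  by_cases h : 𝓥.place j = w
  · rw [h, localComponent_ofLocal]
    exact glDiagonal_uniformizerAt_mem_integralAt K 2 w i
  · rw [localComponent_ofLocal_of_ne h]
    exact one_mem _

/-- For `w` not a place of `λ`, all of `GL₂(K_w)` (embedded at `w`) lies in `Δ_λ`. [folklore] -/
theorem ofLocal_mem_heckeMonoid {w : HeightOneSpectrum (𝓞 K)} (hw : ∀ j, 𝓥.place j ≠ w)
    (y : GL (Fin 2) (w.adicCompletion K)) : ofLocal 2 K w y ∈ 𝓥.heckeMonoid := by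
  rw [mem_heckeMonoid_iff]
  intro j
  rw [localComponent_ofLocal_of_ne (hw j)]
  exact one_mem _

/-! #### The Hecke module `H_*(U, V_λ(𝒪))`, `H^*(U, V_λ(𝒪))` -/

section Level

variable (U : Subgroup (FiniteAdelicGL 2 K)) (hU : U ≤ glFiniteIntegralLevel 2 K)

/-- **`H_i(U, V_λ(𝒪))`**, the INTEGRAL weight-`λ` homology of the arithmetic quotient of `GL₂/K`
of level `U ≤ GL₂(𝒪̂_K)` with coefficients at `p`: `H_i(GL₂(K), M_c(U, τ_λ))`, by Shapiro
`⊕_{x ∈ GL₂(K)\GL₂(𝔸_K^∞)/U} H_i(Γ_x, V_λ(𝒪))`, `Γ_x = GL₂(K) ∩ xUx⁻¹` acting through its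
`p`-components — for `K` imaginary quadratic the homology of the (possibly disconnected) Bianchi
orbifold of level `U` with coefficients `Sym^k ⊗ Sym^{k'}`. A module over the anemic Hecke
algebra (`anemicHeckeAlgebra`). [cite: AllenCalegariCaraianiGeeEtAl2023, §2.1.2 and §2.2.1]
[cite: Hida1994AIF, §1] [cite: CalegariVenkatesh2019, §2] -/
def _root_.Literature.NumberTheory.Automorphic.IntegralWeightHeckeModuleGL2 (i : ℕ) :
    ModuleCat 𝒪 :=
  LevelAction.homology (globalEmbedding 2 K) 𝓥.heckeMonoid 𝓥.coeffAction U i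

/-- **`H^i(U, V_λ(𝒪))`**, the integral weight-`λ` COHOMOLOGY of level `U` with coefficients at
`p`: `H^i(GL₂(K), M(U, τ_λ))` (all `U`-equivariant sections). [cite: Hida1994AIF, §1]
[cite: AllenCalegariCaraianiGeeEtAl2023, §2.1.2] -/
def cohomology (i : ℕ) : ModuleCat 𝒪 :=
  LevelAction.cohomology (globalEmbedding 2 K) 𝓥.heckeMonoid 𝓥.coeffAction U i

variable {U}

/-- The Hecke operator `[U g U]` of `g ∈ Δ_λ` on `H_i(U, V_λ(𝒪))` (for a Hecke pair `U`, e.g.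
compact open). [cite: AllenCalegariCaraianiGeeEtAl2023, §2.1.3] -/
def hecke [IsHeckeTriple (⊤ : Submonoid (FiniteAdelicGL 2 K)) U U] {g : FiniteAdelicGL 2 K}
    (hg : g ∈ 𝓥.heckeMonoid) (i : ℕ) : Module.End 𝒪 (IntegralWeightHeckeModuleGL2 𝓥 U i) :=
  LevelAction.heckeHomology (globalEmbedding 2 K) 𝓥.heckeMonoid 𝓥.coeffAction U
    (𝓥.le_heckeMonoid hU) hg i

/-- The Hecke operator `[U g U]` of `g ∈ Δ_λ` on `H^i(U, V_λ(𝒪))`.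
[cite: AllenCalegariCaraianiGeeEtAl2023, §2.1.3] -/
def heckeCoh {g : FiniteAdelicGL 2 K} (hg : g ∈ 𝓥.heckeMonoid) (i : ℕ) :
    Module.End 𝒪 (𝓥.cohomology U i) :=
  LevelAction.heckeCohomology (globalEmbedding 2 K) 𝓥.heckeMonoid 𝓥.coeffAction U
    (𝓥.le_heckeMonoid hU) hg i

variable [IsHeckeTriple (⊤ : Submonoid (FiniteAdelicGL 2 K)) U U]

/-- **`T_w = [U diag(ϖ_w, 1) U]`** on `H_i(U, V_λ(𝒪))` (the spherical `T_{w,1}` for `w ∉ S`; at a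
place `v` of `λ` with `U_v` of Iwahori / `U₁(p^r)` type it is the `p`-INTEGRAL operator
`U_v = [U diag(ϖ_v,1) U]`, `diag(ϖ_v,1)` acting on `Sym^{k_v}(𝒪²)` by
`X₀^aX₁^{k−a} ↦ ϖ^a X₀^aX₁^{k−a}`, see `heckeU`).
[cite: AllenCalegariCaraianiGeeEtAl2023, §2.2.2] -/
def heckeT (w : HeightOneSpectrum (𝓞 K)) (i : ℕ) :
    Module.End 𝒪 (IntegralWeightHeckeModuleGL2 𝓥 U i) :=
  𝓥.hecke hU (𝓥.heckeElement_mem_heckeMonoid w 1) i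

/-- **`S_w = [U diag(ϖ_w, ϖ_w) U]`** on `H_i(U, V_λ(𝒪))` (`T_{w,2}`).
[cite: AllenCalegariCaraianiGeeEtAl2023, §2.2.2] -/
def heckeS (w : HeightOneSpectrum (𝓞 K)) (i : ℕ) :
    Module.End 𝒪 (IntegralWeightHeckeModuleGL2 𝓥 U i) :=
  𝓥.hecke hU (𝓥.heckeElement_mem_heckeMonoid w 2) i

/-- **`U_v = [U diag(ϖ_v, 1) U]`**, the `p`-integrally normalised Hecke operator at a place `v`
of `λ` (same double coset as `heckeT`; the name records the intended use at `v ∣ p` with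
`U_v ⊊ GL₂(𝒪_v)`; it depends on the fixed uniformiser `uniformizerAt v`).
[cite: AllenCalegariCaraianiGeeEtAl2023, §2.2.2] -/
abbrev heckeU (v : HeightOneSpectrum (𝓞 K)) (i : ℕ) :
    Module.End 𝒪 (IntegralWeightHeckeModuleGL2 𝓥 U i) :=
  𝓥.heckeT hU v i

/-! #### The anemic Hecke algebra, its commutativity, localisation and the `p`-torsion exponent -/

/-- The generators `T_w, S_w`, `w ∉ S`, of the anemic Hecke algebra. [folklore] -/
def anemicGenerators (S : Set (HeightOneSpectrum (𝓞 K))) (i : ℕ) :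
    Set (Module.End 𝒪 (IntegralWeightHeckeModuleGL2 𝓥 U i)) :=
  {T | ∃ w ∉ S, T = 𝓥.heckeT hU w i ∨ T = 𝓥.heckeS hU w i}

/-- **The anemic Hecke algebra `𝕋^{S,an} = 𝒪[T_w, S_w : w ∉ S]`** acting on `H_i(U, V_λ(𝒪))`
(Mathlib `Algebra.adjoin` inside `End_𝒪`): the image of `𝕋^S = ℋ(GL₂(𝔸^{∞,S}), U^S) ⊗ 𝒪` for
`U` hyperspecial outside `S` (there `ℋ(GL₂(K_w), GL₂(𝒪_w)) = ℤ[T_w, S_w^{±1}]`; `S_w⁻¹` is not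
adjoined, which does not change the maximal ideals in the support).
[cite: AllenCalegariCaraianiGeeEtAl2023, §2.2.1] -/
def anemicHeckeAlgebra (S : Set (HeightOneSpectrum (𝓞 K))) (i : ℕ) :
    Subalgebra 𝒪 (Module.End 𝒪 (IntegralWeightHeckeModuleGL2 𝓥 U i)) :=
  Algebra.adjoin 𝒪 (𝓥.anemicGenerators hU S i)

/-- **The anemic Hecke operators commute** when `S` contains the places of `λ` and `U` is
unramified (`U = Uʷ × GL₂(𝒪_w)`, `ArithmeticQuotient.IsUnramifiedLevel`) at every `w ∉ S`:
different places by `LevelAction.heckeOp_comm_apply_of_orthogonal`, `T_w` with `S_w` because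
`diag(ϖ_w, ϖ_w)` is central. [cite: AllenCalegariCaraianiGeeEtAl2023, §2.2.1] -/
theorem anemicGenerators_comm {S : Set (HeightOneSpectrum (𝓞 K))} (hS : ∀ j, 𝓥.place j ∈ S)
    (hunr : ∀ w ∉ S, ArithmeticQuotient.IsUnramifiedLevel
      (valuedCongruenceSubgroup (F := w.adicCompletion K) (Fin 2)
        (1 : WithZero (Multiplicative ℤ))) (ofLocal 2 K w) (localComponent 2 K w) U)
    (i : ℕ) : ∀ a ∈ 𝓥.anemicGenerators hU S i, ∀ b ∈ 𝓥.anemicGenerators hU S i, a * b = b * a := by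
  have hplace : ∀ w ∉ S, ∀ j, 𝓥.place j ≠ w := fun w hw j h => hw (h ▸ hS j)
  -- every generator is the operator of `ofLocal w x` for some `w ∉ S`, `x ∈ GL₂(K_w)`
  have hgen : ∀ a ∈ 𝓥.anemicGenerators hU S i, ∃ w, ∃ hw : w ∉ S,
      ∃ x : GL (Fin 2) (w.adicCompletion K), ∃ hx : ofLocal 2 K w x ∈ 𝓥.heckeMonoid,
        a = 𝓥.hecke hU hx i ∧
          (x = glDiagonal 2 _ (fun l => if l.val < 1 then uniformizerAt w else 1) ∨
            x = glDiagonal 2 _ (fun l => if l.val < 2 then uniformizerAt w else 1)) := by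
    rintro a ⟨w, hw, ha⟩
    rcases ha with rfl | rfl
    · refine ⟨w, hw, _, ?_, ?_, Or.inl rfl⟩
      · rw [← heckeElement_eq_ofLocal]; exact 𝓥.heckeElement_mem_heckeMonoid w 1
      · simp only [heckeT, hecke, heckeElement_eq_ofLocal]
    · refine ⟨w, hw, _, ?_, ?_, Or.inr rfl⟩
      · rw [← heckeElement_eq_ofLocal]; exact 𝓥.heckeElement_mem_heckeMonoid w 2
      · simp only [heckeS, hecke, heckeElement_eq_ofLocal]
  intro a ha b hb
  obtain ⟨w, hw, x, hx, rfl, hxv⟩ := hgen a ha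
  obtain ⟨w', hw', y, hy, rfl, hyv⟩ := hgen b hb
  refine LevelAction.heckeHomology_comm (globalEmbedding 2 K) 𝓥.coeffAction
    (𝓥.le_heckeMonoid hU) hx hy (fun f hf => ?_) i
  by_cases hww : w = w'
  · subst hww
    -- same place: equal elements trivially; `t_{w,1}` with `t_{w,2}` since `t_{w,2}` is central
    have hcent : ∀ g : FiniteAdelicGL 2 K,
        g * ofLocal 2 K w (glDiagonal 2 _ fun l => if l.val < 2 then uniformizerAt w else 1) =
          ofLocal 2 K w (glDiagonal 2 _ fun l => if l.val < 2 then uniformizerAt w else 1) * g := by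
      intro g
      rw [← heckeElement_eq_ofLocal]
      exact mul_heckeElement_self_comm K 2 w g
    rcases hxv with rfl | rfl <;> rcases hyv with rfl | rfl
    · rfl
    · exact LevelAction.heckeOp_comm_apply_of_central (𝓥.le_heckeMonoid hU) hy hcent hx hf.1
    · exact (LevelAction.heckeOp_comm_apply_of_central (𝓥.le_heckeMonoid hU) hx hcent hy hf.1).symm
    · rfl
  · exact LevelAction.heckeOp_comm_apply_of_orthogonal (hunr w hw) (hunr w' hw')
      (𝓥.le_heckeMonoid hU) (𝓥.ofLocal_mem_heckeMonoid (hplace w hw))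
      (𝓥.ofLocal_mem_heckeMonoid (hplace w' hw'))
      (fun z => localComponent_ofLocal_of_ne (Ne.symm hww) z) x y hf.1

open scoped IsMulCommutative in
/-- The commutative-ring structure on the anemic Hecke algebra (same operations as the Mathlib
`Ring` structure of the subalgebra), from `anemicGenerators_comm`
(`Algebra.isMulCommutative_adjoin` and the scoped `IsMulCommutative` instances). [folklore] -/
abbrev commRing {S : Set (HeightOneSpectrum (𝓞 K))} (hS : ∀ j, 𝓥.place j ∈ S)
    (hunr : ∀ w ∉ S, ArithmeticQuotient.IsUnramifiedLevel
      (valuedCongruenceSubgroup (F := w.adicCompletion K) (Fin 2)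
        (1 : WithZero (Multiplicative ℤ))) (ofLocal 2 K w) (localComponent 2 K w) U)
    (i : ℕ) : CommRing (𝓥.anemicHeckeAlgebra hU S i) :=
  have : IsMulCommutative (𝓥.anemicHeckeAlgebra hU S i) :=
    Algebra.isMulCommutative_adjoin 𝒪 (𝓥.anemicGenerators_comm hU hS hunr i)
  inferInstance

/-- In the (commutative) anemic Hecke algebra a maximal ideal is prime. [folklore] -/
theorem isPrime_of_isMaximal {S : Set (HeightOneSpectrum (𝓞 K))} (hS : ∀ j, 𝓥.place j ∈ S)
    (hunr : ∀ w ∉ S, ArithmeticQuotient.IsUnramifiedLevel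
      (valuedCongruenceSubgroup (F := w.adicCompletion K) (Fin 2)
        (1 : WithZero (Multiplicative ℤ))) (ofLocal 2 K w) (localComponent 2 K w) U)
    (i : ℕ) (𝔪 : Ideal (𝓥.anemicHeckeAlgebra hU S i)) [h𝔪 : 𝔪.IsMaximal] : 𝔪.IsPrime :=
  letI := 𝓥.commRing hU hS hunr i
  Ideal.IsMaximal.isPrime h𝔪

/-- **`H_i(U, V_λ(𝒪))_𝔪`**, the localisation of the Hecke module at a maximal ideal `𝔪` of the
anemic Hecke algebra (Mathlib `LocalizedModule` at `𝕋 ∖ 𝔪`, a prime by `isPrime_of_isMaximal`).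
[cite: AllenCalegariCaraianiGeeEtAl2023, §1] [cite: CalegariVenkatesh2019, §2] -/
def localizedHomology {S : Set (HeightOneSpectrum (𝓞 K))} (hS : ∀ j, 𝓥.place j ∈ S)
    (hunr : ∀ w ∉ S, ArithmeticQuotient.IsUnramifiedLevel
      (valuedCongruenceSubgroup (F := w.adicCompletion K) (Fin 2)
        (1 : WithZero (Multiplicative ℤ))) (ofLocal 2 K w) (localComponent 2 K w) U)
    (i : ℕ) (𝔪 : Ideal (𝓥.anemicHeckeAlgebra hU S i)) [𝔪.IsMaximal] : Type :=
  letI := 𝓥.commRing hU hS hunr i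
  haveI := 𝓥.isPrime_of_isMaximal hU hS hunr i 𝔪
  LocalizedModule 𝔪.primeCompl (IntegralWeightHeckeModuleGL2 𝓥 U i)

namespace localizedHomology

variable {S : Set (HeightOneSpectrum (𝓞 K))} (hS : ∀ j, 𝓥.place j ∈ S)
  (hunr : ∀ w ∉ S, ArithmeticQuotient.IsUnramifiedLevel
    (valuedCongruenceSubgroup (F := w.adicCompletion K) (Fin 2)
      (1 : WithZero (Multiplicative ℤ))) (ofLocal 2 K w) (localComponent 2 K w) U)
  (i : ℕ) (𝔪 : Ideal (𝓥.anemicHeckeAlgebra hU S i)) [𝔪.IsMaximal]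

/-- `H_i(U, V_λ(𝒪))_𝔪` is an additive group (Mathlib's, on the localised module). [folklore] -/
instance : AddCommGroup (localizedHomology 𝓥 hU hS hunr i 𝔪) := by
  letI := 𝓥.commRing hU hS hunr i
  haveI := 𝓥.isPrime_of_isMaximal hU hS hunr i 𝔪
  exact inferInstanceAs (AddCommGroup (LocalizedModule 𝔪.primeCompl _))

/-- `H_i(U, V_λ(𝒪))_𝔪` is a module over the anemic Hecke algebra. [folklore] -/
instance : Module (𝓥.anemicHeckeAlgebra hU S i) (localizedHomology 𝓥 hU hS hunr i 𝔪) := by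
  letI := 𝓥.commRing hU hS hunr i
  haveI := 𝓥.isPrime_of_isMaximal hU hS hunr i 𝔪
  exact inferInstanceAs (Module (𝓥.anemicHeckeAlgebra hU S i) (LocalizedModule 𝔪.primeCompl _))

/-- The localisation map `H_i(U, V_λ(𝒪)) → H_i(U, V_λ(𝒪))_𝔪` (Hecke-linear). [folklore] -/
def of : IntegralWeightHeckeModuleGL2 𝓥 U i →ₗ[𝓥.anemicHeckeAlgebra hU S i]
    localizedHomology 𝓥 hU hS hunr i 𝔪 := by
  letI := 𝓥.commRing hU hS hunr i
  haveI := 𝓥.isPrime_of_isMaximal hU hS hunr i 𝔪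
  exact LocalizedModule.mkLinearMap 𝔪.primeCompl _

end localizedHomology

end Level

end IntegralWeight

/-- **The `p`-torsion exponent of an abelian group `M`**: the least `t` with `p^t M = 0`, as an
element of `ℕ∞` (`⊤` if no power of `p` kills `M`, e.g. `M` not torsion). [folklore] -/
def torsionExponent (p : ℕ) (M : Type*) [AddCommGroup M] : ℕ∞ :=
  ⨅ (t : ℕ) (_ : ∀ x : M, (p ^ t : ℕ) • x = 0), (t : ℕ∞)

/-- `torsionExponent p M ≤ t` as soon as `p^t M = 0`. [folklore] -/
theorem torsionExponent_le {p : ℕ} {M : Type*} [AddCommGroup M] {t : ℕ}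
    (h : ∀ x : M, (p ^ t : ℕ) • x = 0) : torsionExponent p M ≤ t :=
  iInf₂_le t h

/-- `torsionExponent p M = ⊤` iff no power of `p` kills `M`. [folklore] -/
theorem torsionExponent_eq_top_iff {p : ℕ} {M : Type*} [AddCommGroup M] :
    torsionExponent p M = ⊤ ↔ ∀ t : ℕ, ∃ x : M, (p ^ t : ℕ) • x ≠ 0 := by
  simp [torsionExponent, iInf_eq_top]

namespace IntegralWeight

variable {K : Type} [Field K] [NumberField K] {𝒪 : Type} [CommRing 𝒪] {J : Type}
  (𝓥 : IntegralWeight K 𝒪 J) {U : Subgroup (FiniteAdelicGL 2 K)}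
  (hU : U ≤ glFiniteIntegralLevel 2 K) [IsHeckeTriple (⊤ : Submonoid (FiniteAdelicGL 2 K)) U U]

/-- **The `p`-exponent of `H_i(U, V_λ(𝒪))_𝔪`**:
`heckeTorsionExponent … 𝔪 = inf {t | p^t · H_i(U, V_λ(𝒪))_𝔪 = 0} ∈ ℕ∞`
(`⊤` when the `𝔪`-part is not killed by any power of `p`, e.g. not torsion) — the quantity whose
growth along `p`-adic weight arcs the route `RuelleTorsionArtinWeight` studies. [folklore] -/
def heckeTorsionExponent (p : ℕ) {S : Set (HeightOneSpectrum (𝓞 K))} (hS : ∀ j, 𝓥.place j ∈ S)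
    (hunr : ∀ w ∉ S, ArithmeticQuotient.IsUnramifiedLevel
      (valuedCongruenceSubgroup (F := w.adicCompletion K) (Fin 2)
        (1 : WithZero (Multiplicative ℤ))) (ofLocal 2 K w) (localComponent 2 K w) U)
    (i : ℕ) (𝔪 : Ideal (𝓥.anemicHeckeAlgebra hU S i)) [𝔪.IsMaximal] : ℕ∞ :=
  torsionExponent p (localizedHomology 𝓥 hU hS hunr i 𝔪)

end IntegralWeight

end IntegralWeightGL2

end Literature.NumberTheory.Automorphic
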